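import Literature.NumberTheory.LFunctions.Zhang2022.Section8ChangeOfVariables
import Literature.NumberTheory.LFunctions.Zhang2022.Section10Certificate
import Literature.Analysis.Complex.OffCentreCauchyFormula

/-!
# Zhang (2022) §10: from Lemmas 10.1–10.2 to the printed `d₃ⱼ, …, d₆ⱼ`, `𝔡′ + 𝔡`, `d₇ⱼ`, kernel-checked

Trunk T-ANT (NumberTheory/LFunctions). Companion of `Section10Defs.lean`, `Section10ClosedForm.lean`,
`Section10Certificate.lean` and of the §8 files `Section8MainTerms.lean`, `Section8ChangeOfVariables.lean`
(Y. Zhang, *Discrete mean estimates and the Landau–Siegel zero*, arXiv:2211.02515v1 (2022)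
[Zhang2022LandauSiegel], §10, pp. 20–22 of the source, and the proof of (2.33) in §18, p. 36;
**an unrefereed manuscript, a claimed result under adjudication** — this file reproduces the
elementary links (residue calculus at `s = 0` and real changes of variables) of its §10 and asserts
nothing about its Theorems 1–2).

What the companions already carry: `Section10Defs` transcribes the printed profiles `𝔶𝔶_{μj}` and the
printed constants `d₃ⱼ, d₄ⱼ, d′₅ⱼ, d₅ⱼ, d′₆ⱼ, d₆ⱼ, 𝔡′, 𝔡` of (10.12)–(10.17) and `d₇ⱼ, C₂₃₃` of the proof of
(2.33) (§18); `Section10ClosedForm` evaluates them and `Section10Certificate` decides every printed §10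
inequality (`|𝔡′ + 𝔡| = 5.2989… > 5`, so Proposition 2.4 HOLDS at main order; `C₂₃₃ = 2546.84… < 3000`).
What those files deliberately left outside the kernel (`Section10Defs`, "What is deliberately NOT here")
is the DERIVATION of the printed constants from the two lemmas of §10 [p. 20 L43 – p. 22 L141]:

* Lemma 10.1 ((10.2)–(10.5)) and Lemma 10.2 ((10.8)–(10.11)): "the residue of … at `s = 0` is equal to"
  `−1 − β_j log(y/P₂′)`, `1 − β_j log(P₁′/y)`, resp. `β_{j+1}β_{j+2} log P/500`, `−1 + 𝔶₁ⱼ(y)`,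
  `1 + 𝔶₂ⱼ(y)` on the three ranges, via (10.6)–(10.7) (`f̃` as a Mellin integral of
  `((P₁′)ˢ − 2(P₂′)ˢ + (P₃′)ˢ)/s²`);
* "`𝔶₁ⱼ(Pᶻ) = 𝔶𝔶₁ⱼ(z) + O(ℒ⁻⁸)`, `𝔶₂ⱼ(Pᶻ) = 𝔶𝔶₂ⱼ(z) + O(ℒ⁻⁸)`" with the six printed `𝔶𝔶_{μj}` (p. 21);
* the range-by-range displays "the sum over `P^{a} ≤ dr < P^{b}` is equal to … `= (…𝔞/log P)∫ … dz + o(α)`"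
  before (10.12), (10.13), (10.14) and (10.15) ("substituting `x = Pᶻ`", then `z ↦ θ − z`), and
  "Gathering the above results together we conclude `α⁻¹S_j(·,·) = (…)𝔞 + o(1)`" with the printed `d`'s;
* "It follows from (10.1) and (10.12)–(10.16) that `Ξ₁* = (𝔡′ + 𝔡)𝔞𝔓 + o(𝔓)`" (10.17);
* §18: the two `n`-sums of the proof of (2.33), whose summands are the products of the Lemma 10.1 and
  Lemma 10.2 residues, and `C₂₃₃` ((18.3) with Proposition 7.1).

This file PROVES these links EXACTLY, at main order, i.e. with the following (and only the following)
idealisations, each of which is one of the manuscript's own `o(·)` simplifications: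
(M1) the shifts at their main values `β_j = β_j⁰ = jiα`, `(β_{j+1}, β_{j+2}) = (β_{b₁}⁰, β_{b₂}⁰)` with
`(b₁,b₂) = (2,3), (3,1), (1,2)` (after `β₄ = β₁, β₅ = β₂`), `β₆, β₇ = 3iα/2, 5iα/2`, and `α log P = π`
(as in `Section8MainTerms`; the manuscript's "`+O(ℒ⁻⁸)`", "`β_{j+1}β_{j+2}log P = −(11 − 6j + j²)πα + o(α)`");
(M2) pure-power scales: `P_k′ = P^{0.504}, P^{0.502}, P^{0.5}`, `P₂ = P^{0.5}`, `P₃ = P^{0.498}` and the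
breakpoints `P^{0.496}, …, P^{0.504}` (the `/T`, `Dt₀` windows and `α̃` are `o(α)` by (10.5), (10.11));
(M3) the factors `𝔞`, `L′(1,ψ)`, `Π(d,r)` and all `o(α)`, `O(ℒ⁻¹⁵)` terms are omitted — the residues are
the normalised circle integrals `(2πi)⁻¹∮`, on ANY circle around `0` (the manuscript's is `|s| = 5α`);
(M4) the §8 rule `Σₙ|χ(n)|λ₀ⱼ(n)φ(n)⁻¹g(n) = (𝔞/L′(1,χ)²)∫g(x)dx/x + …` is applied formally: Part B
starts from the `∫ … dx/x` expressions (normalised by `𝔞`), with abstract profiles `F(Pᶻ) = f(z)`.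

| decl | display | content |
|---|---|---|
| `circleIntegral_div_pow_zero`, `circleIntegral_lemma101/102` | "the residue at `s = 0`" | `(2πi)⁻¹∮f(s)(s − β)s⁻²ds = f(0) − βf′(0)`, `(2πi)⁻¹∮(β₁+s)(β₂+s)f(s)s⁻³ds = f(0) + (β₁+β₂)f′(0) + (β₁β₂/2)f″(0)`, any entire `f`, any circle around `0` (from `Literature.Analysis.Complex.circleIntegral_div_sub_pow_eq_iteratedDeriv`) |
| `lemma101_residue*`, `lemma102_residue*` | (10.6)–(10.7) numerators | the same for `f(s) = e^{sL_A} − 2e^{sL_B} (+ e^{sL_C})` |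
| `yfrak1`, `yfrak2` | Lemma 10.2 | `𝔶₁ⱼ(y)`, `𝔶₂ⱼ(y)` as functions of the shifts, `log P`, `y` |
| `lemma101_range1/2/3` | (10.2)–(10.4) | PROVED: residues `0`, `−1 − β_j log(y/P^{0.5})`, `1 − β_j log(P^{0.504}/y)` |
| `lemma102_range1/2/3`, `prefactor_108` | (10.8)–(10.10) | PROVED: residues `β_{j+1}β_{j+2}(log P/500)²` (× `500/log P` = (10.8)), `−1 + 𝔶₁ⱼ(y)`, `1 + 𝔶₂ⱼ(y)` |
| `yfrak1_main`, `yfrak2_main`, `yfrak*_main_1/2/3` | p. 21 top | PROVED: `𝔶_{μj}(Pᶻ) = 𝔶𝔶_{μj}(z)` EXACTLY at main values (`= Section10Defs.yy11 … yy23`) |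
| `S1113`, `S1321`, `S1422`, `S1214` | proofs of (10.12), (10.13), (10.14), (10.15)–(10.16) | the displayed `∫dx/x` range sums of `S_j(a₁₁,a₁₃)`, `S_j(a₁₃,a₂₁)`, `S_j(a₁₄,a₂₂)`, `S_j(a₁₂,a₁₄)` (over `𝔞`) as functionals of abstract `x`-profiles |
| `S1113_eq_d3F`, `S1321_eq_d4F`, `S1422_eq_d5F`, `S1214_eq_d6F` | "Gathering the above results" | PROVED: `α⁻¹S = d3F`, `d4F`, `d5pF + d5F`, `d6pF + d6F` of `Section10Defs` for ANY continuous `z`-profiles |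
| `S…M`, `S1113M_one` … `S1214M_three` | `d₃₁ … d₆₃` | PROVED at the §8 main-value profiles `fX`, `gX`: `= d31, …, d6p3 + d63` |
| `xi1_star_main_eq_dprime_add_dfrak`, `xi1_star_main_end_to_end` | (10.1), (10.17), Prop. 2.4 | PROVED: the (10.1)/Prop. 7.1-weighted lemma-level sum `X` equals `dprime + dfrak`; `|X| > 5`, `Re X > 5.15886` |
| `S2323`, `S2323_eq_d7F`, `S2323M_*`, `theta1_a23_main_*` | §18, proof of (2.33) | PROVED: `α⁻¹S_j(a₂₃,a₂₃)/𝔞 = d7F` (product of the two lemmas' residues), `2Re{Σcⱼ…} = C233 < 3000` |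

Consequence for the record (no new claim): the kernel now carries the whole computational chain of
§10 — Cauchy's formula at `s = 0` for the (10.6)/(10.7) numerators → the residues of Lemmas 10.1–10.2
in the printed form → `𝔶_{μj}(Pᶻ) = 𝔶𝔶_{μj}(z)` → the `x = Pᶻ` / `z ↦ θ − z` passages → the printed
`d₃ⱼ, d₄ⱼ, d′₅ⱼ + d₅ⱼ, d′₆ⱼ + d₆ⱼ` → (10.17) `𝔡′ + 𝔡` → `|𝔡′ + 𝔡| = 5.2989… > 5` (`Section10Certificate`):
the printed (10.12)–(10.17) ARE the correct outcome of Lemmas 10.1–10.2 under (M1)–(M4) (every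
coefficient `500/(0.504π)`, `1000ι₄/π`, `−(11 − 6j + j²)π/500 = −b₁b₂π/500`, `500ijι₃/0.498`, … and every
shifted argument `0.004 + z`, `0.002 + z`, `0.502 − z`, `0.504 − z` included), so Proposition 2.4's
validity at main order is a statement about the §10 main terms themselves and not an artefact of the
transcription. For (2.33) the lemma-level main term is `d7F` (factor `1 + 𝔶𝔶₂ⱼ` on `[0.502, 0.504]`,
Lemma 10.2 (10.10)); the second display of the proof of (2.33) prints `𝔶₁ⱼ` there (`Section10Defs.d7litF`,
both readings certified `< 3000`). What remains outside the kernel in §10 is the analytic number theory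
proper: Proposition 7.1 and Lemma 8.1 (hence (10.1)); the contour shift to `|s| = 5α` and the error terms
`O(ℒ⁻¹⁵)`, `≪ T^{−c}`, `≪ ℒ⁻⁷` of Lemmas 10.1–10.2 under hypothesis (A); Lemma 8.3/Appendix A
(`Π(d,r)`, `ξ₀ⱼ`); `λ₀ⱼ(n) = φ(n)²/n² + O(α₁)`; and the partial summation producing the `∫dx/x` rule (M4).
-/

noncomputable section

open Complex Real Metric Set MeasureTheory ComplexConjugate

namespace Literature.NumberTheory.LFunctions.Zhang2022

/-! ### The model integrals `(2πi)⁻¹ ∮ f(s) s^{-(n+1)} ds = f⁽ⁿ⁾(0)/n!` -/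

/-- Cauchy's formulae at `0` for an entire `f` on any circle containing `0`:
`(2πi)⁻¹∮ f(s)/s ds = f(0)`, `(2πi)⁻¹∮ f(s)/s² ds = f′(0)`, `(2πi)⁻¹∮ f(s)/s³ ds = f″(0)/2`
(`Literature.Analysis.Complex.circleIntegral_div_sub_pow_eq_iteratedDeriv` with `w = 0`). [folklore] -/
theorem circleIntegral_div_pow_zero {f : ℂ → ℂ} (hf : Differentiable ℂ f) {c : ℂ} {R : ℝ}
    (h0 : (0 : ℂ) ∈ ball c R) (n : ℕ) :
    (2 * π * I)⁻¹ * (∮ s in C(c, R), f s / s ^ (n + 1))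
      = iteratedDeriv n f 0 / n.factorial := by
  have key := Literature.Analysis.Complex.circleIntegral_div_sub_pow_eq_iteratedDeriv
    isOpen_univ hf.differentiableOn (subset_univ _) h0 n
  simp only [sub_zero] at key
  rw [key]
  have h2 : (2 * π * I : ℂ) ≠ 0 := by
    simp [Real.pi_ne_zero, I_ne_zero]
  have hn : (n.factorial : ℂ) ≠ 0 := by exact_mod_cast (Nat.factorial_pos n).ne'
  field_simp

/-- **Lemma 10.1, "the residue … at `s = 0`"**, for an arbitrary entire numerator `f`
(in the manuscript `f(s) = ((P₁′)ˢ − 2(P₂′)ˢ)/yˢ` or `(P₁′/y)ˢ`):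
`(2πi)⁻¹ ∮ f(s)(s − β_j) s⁻² ds = f(0) − β_j f′(0)` on any circle around `0`.
[cite: Zhang2022LandauSiegel, Lemma 10.1 (proof)] -/
theorem circleIntegral_lemma101 {f : ℂ → ℂ} (hf : Differentiable ℂ f) (β : ℂ) {c : ℂ} {R : ℝ}
    (h0 : (0 : ℂ) ∈ ball c R) :
    (2 * π * I)⁻¹ * (∮ s in C(c, R), f s * (s - β) / s ^ 2) = f 0 - β * deriv f 0 := by
  have hR : 0 < R := pos_of_mem_ball h0
  have hne : ∀ s ∈ sphere c R, s ≠ 0 := fun s hs h =>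
    (sphere_disjoint_ball.ne_of_mem hs h0) h
  have hcongr : EqOn (fun s => f s * (s - β) / s ^ 2)
      (fun s => f s / s ^ (0 + 1) - β * (f s / s ^ (1 + 1))) (sphere c R) := by
    intro s hs
    have h := hne s hs
    simp only [zero_add]
    field_simp
    ring
  rw [circleIntegral.integral_congr hR.le hcongr]
  have hfc : ContinuousOn f (sphere c R) := hf.continuous.continuousOn
  have hc1 : ContinuousOn (fun s : ℂ => f s / s ^ (0 + 1)) (sphere c R) :=
    hfc.div (continuousOn_id.pow _) fun s hs => pow_ne_zero _ (hne s hs)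
  have hc2 : ContinuousOn (fun s : ℂ => β * (f s / s ^ (1 + 1))) (sphere c R) :=
    continuousOn_const.mul (hfc.div (continuousOn_id.pow _) fun s hs => pow_ne_zero _ (hne s hs))
  rw [circleIntegral.integral_sub (hc1.circleIntegrable hR.le) (hc2.circleIntegrable hR.le),
    circleIntegral.integral_const_mul]
  have e0 := circleIntegral_div_pow_zero hf h0 0
  have e1 := circleIntegral_div_pow_zero hf h0 1
  calc (2 * π * I)⁻¹ * ((∮ s in C(c, R), f s / s ^ (0 + 1))
          - β * ∮ s in C(c, R), f s / s ^ (1 + 1))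
        = (2 * π * I)⁻¹ * (∮ s in C(c, R), f s / s ^ (0 + 1))
          - β * ((2 * π * I)⁻¹ * ∮ s in C(c, R), f s / s ^ (1 + 1)) := by ring
    _ = f 0 - β * deriv f 0 := by
        rw [e0, e1]
        simp [iteratedDeriv_one, iteratedDeriv_zero, Nat.factorial]

/-- **Lemma 10.2, the residue at `s = 0`**, for an arbitrary entire numerator `f`
(in the manuscript `f(s) = ((P₁′)ˢ − 2(P₂′)ˢ + (P₃′)ˢ)/(dr)ˢ`, or without the last, or the first term
only): `(2πi)⁻¹ ∮ (β_{j+1} + s)(β_{j+2} + s) s⁻¹ f(s) s⁻² ds = f(0) + (β_{j+1} + β_{j+2})f′(0) + ½β_{j+1}β_{j+2}f″(0)`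
on any circle around `0` (partial fractions `(s + β₁)(s + β₂)/s³ = 1/s + (β₁ + β₂)/s² + β₁β₂/s³`).
[cite: Zhang2022LandauSiegel, Lemma 10.2 (proof)] -/
theorem circleIntegral_lemma102 {f : ℂ → ℂ} (hf : Differentiable ℂ f) (β1 β2 : ℂ) {c : ℂ}
    {R : ℝ} (h0 : (0 : ℂ) ∈ ball c R) :
    (2 * π * I)⁻¹ * (∮ s in C(c, R), (β1 + s) * (β2 + s) / s * f s / s ^ 2)
      = f 0 + (β1 + β2) * deriv f 0 + β1 * β2 / 2 * deriv (deriv f) 0 := by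
  have hR : 0 < R := pos_of_mem_ball h0
  have hne : ∀ s ∈ sphere c R, s ≠ 0 := fun s hs h =>
    (sphere_disjoint_ball.ne_of_mem hs h0) h
  have hcongr : EqOn (fun s => (β1 + s) * (β2 + s) / s * f s / s ^ 2)
      (fun s => f s / s ^ (0 + 1) + (β1 + β2) * (f s / s ^ (1 + 1))
        + β1 * β2 * (f s / s ^ (2 + 1))) (sphere c R) := by
    intro s hs
    have h := hne s hs
    simp only [zero_add]
    field_simp
    ring
  rw [circleIntegral.integral_congr hR.le hcongr]
  have hfc : ContinuousOn f (sphere c R) := hf.continuous.continuousOn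
  have hc : ∀ k : ℕ, ContinuousOn (fun s : ℂ => f s / s ^ (k + 1)) (sphere c R) := fun k =>
    hfc.div (continuousOn_id.pow _) fun s hs => pow_ne_zero _ (hne s hs)
  have hi0 : CircleIntegrable (fun s : ℂ => f s / s ^ (0 + 1)) c R := (hc 0).circleIntegrable hR.le
  have hi1 : CircleIntegrable (fun s : ℂ => (β1 + β2) * (f s / s ^ (1 + 1))) c R :=
    (continuousOn_const.mul (hc 1)).circleIntegrable hR.le
  have hi2 : CircleIntegrable (fun s : ℂ => β1 * β2 * (f s / s ^ (2 + 1))) c R :=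
    (continuousOn_const.mul (hc 2)).circleIntegrable hR.le
  have hi01 : CircleIntegrable (fun s : ℂ => f s / s ^ (0 + 1) + (β1 + β2) * (f s / s ^ (1 + 1)))
      c R := hi0.add hi1
  rw [circleIntegral.integral_add hi01 hi2, circleIntegral.integral_add hi0 hi1,
    circleIntegral.integral_const_mul, circleIntegral.integral_const_mul]
  have e0 := circleIntegral_div_pow_zero hf h0 0
  have e1 := circleIntegral_div_pow_zero hf h0 1
  have e2 := circleIntegral_div_pow_zero hf h0 2
  have hd2 : iteratedDeriv 2 f = deriv (deriv f) := by
    rw [show (2 : ℕ) = 1 + 1 from rfl, iteratedDeriv_succ, iteratedDeriv_one]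
  calc (2 * π * I)⁻¹ * ((∮ s in C(c, R), f s / s ^ (0 + 1))
          + (β1 + β2) * (∮ s in C(c, R), f s / s ^ (1 + 1))
          + β1 * β2 * ∮ s in C(c, R), f s / s ^ (2 + 1))
        = (2 * π * I)⁻¹ * (∮ s in C(c, R), f s / s ^ (0 + 1))
          + (β1 + β2) * ((2 * π * I)⁻¹ * ∮ s in C(c, R), f s / s ^ (1 + 1))
          + β1 * β2 * ((2 * π * I)⁻¹ * ∮ s in C(c, R), f s / s ^ (2 + 1)) := by ring
    _ = f 0 + (β1 + β2) * deriv f 0 + β1 * β2 / 2 * deriv (deriv f) 0 := by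
        rw [e0, e1, e2, hd2]
        simp [iteratedDeriv_one, iteratedDeriv_zero, Nat.factorial]
        ring

/-! ### The tent numerators `((P₁′)ˢ − 2(P₂′)ˢ + (P₃′)ˢ)/yˢ` and their derivatives at `0` -/

/-- One exponential `(Q/y)ˢ = e^{sL}`, `L = log(Q/y)`. [cite: Zhang2022LandauSiegel, (10.6)] -/
def texp1 (LA : ℂ) (s : ℂ) : ℂ := cexp (s * LA)

/-- `((P₁′)ˢ − 2(P₂′)ˢ)/yˢ = e^{sL_A} − 2e^{sL_B}` ((10.7)). [cite: Zhang2022LandauSiegel, (10.7)] -/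
def texp2 (LA LB : ℂ) (s : ℂ) : ℂ := cexp (s * LA) - 2 * cexp (s * LB)

/-- `((P₁′)ˢ − 2(P₂′)ˢ + (P₃′)ˢ)/yˢ = e^{sL_A} − 2e^{sL_B} + e^{sL_C}` ((10.6)).
[cite: Zhang2022LandauSiegel, (10.6)] -/
def texp3 (LA LB LC : ℂ) (s : ℂ) : ℂ := cexp (s * LA) - 2 * cexp (s * LB) + cexp (s * LC)

/-- `d/ds e^{sL} = L e^{sL}`. [folklore] -/
theorem hasDerivAt_cexp_mul_const (L s : ℂ) :
    HasDerivAt (fun s : ℂ => cexp (s * L)) (L * cexp (s * L)) s := by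
  have h : HasDerivAt (fun s : ℂ => cexp (s * L)) (cexp (s * L) * (1 * L)) s :=
    (Complex.hasDerivAt_exp (s * L)).comp s ((hasDerivAt_id s).mul_const L)
  convert h using 1
  ring

/-- `texp1` is entire. [folklore] -/
theorem differentiable_texp1 (LA : ℂ) : Differentiable ℂ (texp1 LA) := by
  unfold texp1; fun_prop
/-- `texp2` is entire. [folklore] -/
theorem differentiable_texp2 (LA LB : ℂ) : Differentiable ℂ (texp2 LA LB) := by
  unfold texp2; fun_prop
/-- `texp3` is entire. [folklore] -/
theorem differentiable_texp3 (LA LB LC : ℂ) : Differentiable ℂ (texp3 LA LB LC) := by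
  unfold texp3; fun_prop

/-- `d/ds e^{sL_A}`. [folklore] -/
theorem deriv_texp1 (LA : ℂ) : deriv (texp1 LA) = fun s => LA * cexp (s * LA) := by
  funext s; exact (hasDerivAt_cexp_mul_const LA s).deriv

/-- `d/ds (e^{sL_A} − 2e^{sL_B})`. [folklore] -/
theorem deriv_texp2 (LA LB : ℂ) :
    deriv (texp2 LA LB) = fun s => LA * cexp (s * LA) - 2 * (LB * cexp (s * LB)) := by
  funext s
  exact ((hasDerivAt_cexp_mul_const LA s).sub
    ((hasDerivAt_cexp_mul_const LB s).const_mul 2)).deriv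

/-- `d/ds (e^{sL_A} − 2e^{sL_B} + e^{sL_C})`. [folklore] -/
theorem deriv_texp3 (LA LB LC : ℂ) :
    deriv (texp3 LA LB LC)
      = fun s => LA * cexp (s * LA) - 2 * (LB * cexp (s * LB)) + LC * cexp (s * LC) := by
  funext s
  exact (((hasDerivAt_cexp_mul_const LA s).sub
    ((hasDerivAt_cexp_mul_const LB s).const_mul 2)).add (hasDerivAt_cexp_mul_const LC s)).deriv

/-- Second derivative of `e^{sL_A}` at `0`: `L_A²`. [folklore] -/
theorem deriv_deriv_texp1 (LA : ℂ) : deriv (deriv (texp1 LA)) 0 = LA ^ 2 := by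
  rw [deriv_texp1]
  have h : HasDerivAt (fun s : ℂ => LA * cexp (s * LA)) (LA * (LA * cexp (0 * LA))) 0 :=
    (hasDerivAt_cexp_mul_const LA 0).const_mul LA
  rw [h.deriv]
  simp; ring

/-- Second derivative of `e^{sL_A} − 2e^{sL_B}` at `0`: `L_A² − 2L_B²`. [folklore] -/
theorem deriv_deriv_texp2 (LA LB : ℂ) : deriv (deriv (texp2 LA LB)) 0 = LA ^ 2 - 2 * LB ^ 2 := by
  rw [deriv_texp2]
  have h : HasDerivAt (fun s : ℂ => LA * cexp (s * LA) - 2 * (LB * cexp (s * LB)))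
      (LA * (LA * cexp (0 * LA)) - 2 * (LB * (LB * cexp (0 * LB)))) 0 :=
    ((hasDerivAt_cexp_mul_const LA 0).const_mul LA).sub
      (((hasDerivAt_cexp_mul_const LB 0).const_mul LB).const_mul 2)
  rw [h.deriv]
  simp; ring

/-- Second derivative of the tent numerator at `0`: `L_A² − 2L_B² + L_C²`. [folklore] -/
theorem deriv_deriv_texp3 (LA LB LC : ℂ) :
    deriv (deriv (texp3 LA LB LC)) 0 = LA ^ 2 - 2 * LB ^ 2 + LC ^ 2 := by
  rw [deriv_texp3]
  have h : HasDerivAt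
      (fun s : ℂ => LA * cexp (s * LA) - 2 * (LB * cexp (s * LB)) + LC * cexp (s * LC))
      (LA * (LA * cexp (0 * LA)) - 2 * (LB * (LB * cexp (0 * LB))) + LC * (LC * cexp (0 * LC))) 0 :=
    (((hasDerivAt_cexp_mul_const LA 0).const_mul LA).sub
      (((hasDerivAt_cexp_mul_const LB 0).const_mul LB).const_mul 2)).add
      ((hasDerivAt_cexp_mul_const LC 0).const_mul LC)
  rw [h.deriv]
  simp; ring

/-! ### Lemma 10.1: the three residues -/

/-- Lemma 10.1, case `P^{0.502} < y ≤ P^{0.504}/T` ((10.4)): with one exponential `(P₁′/y)ˢ = e^{sL}`,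
`(2πi)⁻¹ ∮ e^{sL}(s − β_j)/s² ds = 1 − β_j L` (`L = log(P^{0.504}/y)`).
[cite: Zhang2022LandauSiegel, Lemma 10.1, (10.4)] -/
theorem lemma101_residue1 (β LA : ℂ) {c : ℂ} {R : ℝ} (h0 : (0 : ℂ) ∈ ball c R) :
    (2 * π * I)⁻¹ * (∮ s in C(c, R), texp1 LA s * (s - β) / s ^ 2) = 1 - β * LA := by
  rw [circleIntegral_lemma101 (differentiable_texp1 LA) β h0, deriv_texp1]
  simp [texp1]

/-- Lemma 10.1, case `P^{0.5} < y ≤ P^{0.502}/T` ((10.3)): "the residue of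
`((P₁′)ˢ − 2(P₂′)ˢ) y⁻ˢ (s − β_j) s⁻²` at `s = 0` is equal to `−1 − β_j log(y/P^{0.5})`" — in terms of
`L_A = log(P₁′/y)`, `L_B = log(P₂′/y)` the residue is `−1 − β_j(L_A − 2L_B)` (and
`L_A − 2L_B = log(y/P^{0.5})`, `tent_lin2`). [cite: Zhang2022LandauSiegel, Lemma 10.1, (10.3)] -/
theorem lemma101_residue2 (β LA LB : ℂ) {c : ℂ} {R : ℝ} (h0 : (0 : ℂ) ∈ ball c R) :
    (2 * π * I)⁻¹ * (∮ s in C(c, R), texp2 LA LB s * (s - β) / s ^ 2)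
      = -1 - β * (LA - 2 * LB) := by
  rw [circleIntegral_lemma101 (differentiable_texp2 LA LB) β h0, deriv_texp2]
  simp [texp2]; ring

/-- Lemma 10.1 / (10.6), case `y ≤ P^{0.5}` (all three exponentials): the residue is
`−β_j(L_A − 2L_B + L_C)`, which VANISHES for the manuscript's exponents (`tent_lin3`) — consistent with
`f̃(log y/log P) = 0` for `y ≤ P^{0.5}` and (10.2). [cite: Zhang2022LandauSiegel, Lemma 10.1, (10.2), (10.6)] -/
theorem lemma101_residue3 (β LA LB LC : ℂ) {c : ℂ} {R : ℝ} (h0 : (0 : ℂ) ∈ ball c R) :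
    (2 * π * I)⁻¹ * (∮ s in C(c, R), texp3 LA LB LC s * (s - β) / s ^ 2)
      = -β * (LA - 2 * LB + LC) := by
  rw [circleIntegral_lemma101 (differentiable_texp3 LA LB LC) β h0, deriv_texp3]
  simp [texp3]; ring

/-! ### Lemma 10.2: the three residues -/

/-- The generic polynomial behind `𝔶₁ⱼ, 𝔶₂ⱼ`: `1 + (β₁ + β₂)L + ½β₁β₂L²` is the residue of
`(β₁ + s)(β₂ + s)s⁻¹ e^{sL} s⁻²` at `0`. [cite: Zhang2022LandauSiegel, Lemma 10.2 (proof)] -/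
theorem lemma102_residue1 (β1 β2 LA : ℂ) {c : ℂ} {R : ℝ} (h0 : (0 : ℂ) ∈ ball c R) :
    (2 * π * I)⁻¹ * (∮ s in C(c, R), (β1 + s) * (β2 + s) / s * texp1 LA s / s ^ 2)
      = 1 + (β1 + β2) * LA + β1 * β2 / 2 * LA ^ 2 := by
  rw [circleIntegral_lemma102 (differentiable_texp1 LA) β1 β2 h0, deriv_deriv_texp1, deriv_texp1]
  simp [texp1]

/-- Lemma 10.2, two exponentials ((10.9)): residue `−1 + (β₁ + β₂)(L_A − 2L_B) + ½β₁β₂(L_A² − 2L_B²)`.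
[cite: Zhang2022LandauSiegel, Lemma 10.2, (10.9)] -/
theorem lemma102_residue2 (β1 β2 LA LB : ℂ) {c : ℂ} {R : ℝ} (h0 : (0 : ℂ) ∈ ball c R) :
    (2 * π * I)⁻¹ * (∮ s in C(c, R), (β1 + s) * (β2 + s) / s * texp2 LA LB s / s ^ 2)
      = -1 + (β1 + β2) * (LA - 2 * LB) + β1 * β2 / 2 * (LA ^ 2 - 2 * LB ^ 2) := by
  rw [circleIntegral_lemma102 (differentiable_texp2 LA LB) β1 β2 h0, deriv_deriv_texp2,
    deriv_texp2]
  simp [texp2]; ring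

/-- Lemma 10.2, three exponentials ((10.8)): residue
`(β₁ + β₂)(L_A − 2L_B + L_C) + ½β₁β₂(L_A² − 2L_B² + L_C²)` (the constant terms cancel).
[cite: Zhang2022LandauSiegel, Lemma 10.2, (10.8)] -/
theorem lemma102_residue3 (β1 β2 LA LB LC : ℂ) {c : ℂ} {R : ℝ} (h0 : (0 : ℂ) ∈ ball c R) :
    (2 * π * I)⁻¹ * (∮ s in C(c, R), (β1 + s) * (β2 + s) / s * texp3 LA LB LC s / s ^ 2)
      = (β1 + β2) * (LA - 2 * LB + LC) + β1 * β2 / 2 * (LA ^ 2 - 2 * LB ^ 2 + LC ^ 2) := by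
  rw [circleIntegral_lemma102 (differentiable_texp3 LA LB LC) β1 β2 h0, deriv_deriv_texp3,
    deriv_texp3]
  simp [texp3]; ring

/-! ### The manuscript's exponents `L_θ = log(P^θ/y)` and the tent identities -/

/-- `log(Pᵃ/Pᵇ) = (a − b) log P`. [folklore] -/
theorem log_Ppow_div_Ppow (Λ a b : ℝ) : Real.log (Ppow Λ a / Ppow Λ b) = Λ * (a - b) := by
  rw [Ppow_div_Ppow, Real.log_exp]

/-- `log(P^θ/y) = θ log P − log y` (`y > 0`). [folklore] -/
theorem log_Ppow_div {Λ θ y : ℝ} (hy : 0 < y) : Real.log (Ppow Λ θ / y) = Λ * θ - Real.log y := by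
  rw [Real.log_div (Ppow_pos Λ θ).ne' hy.ne', log_Ppow]

/-- `log(y/P^θ) = log y − θ log P` (`y > 0`). [folklore] -/
theorem log_div_Ppow {Λ θ y : ℝ} (hy : 0 < y) : Real.log (y / Ppow Λ θ) = Real.log y - Λ * θ := by
  rw [Real.log_div hy.ne' (Ppow_pos Λ θ).ne', log_Ppow]

/-- Lemma 10.1, linear tent identity with two terms (`P₁′ = P^{0.504}`, `P₂′ = P^{0.502}`):
`log(P₁′/y) − 2log(P₂′/y) = log(y/P^{0.5})` — why the residue in (10.3) reads `−1 − β_j log(y/P^{0.5})`.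
[cite: Zhang2022LandauSiegel, Lemma 10.1 (proof of (10.3))] -/
theorem tent_lin2 {Λ y : ℝ} (hy : 0 < y) :
    Real.log (Ppow Λ 0.504 / y) - 2 * Real.log (Ppow Λ 0.502 / y) = Real.log (y / Ppow Λ 0.5) := by
  rw [log_Ppow_div hy, log_Ppow_div hy, log_div_Ppow hy]; ring

/-- (10.6) for `y ≤ P^{0.5}`: the full linear tent vanishes, `log(P₁′/y) − 2log(P₂′/y) + log(P₃′/y) = 0`
(`P₃′ = P^{0.5}`), i.e. `f̃(log y/log P) = 0` there — the main term behind (10.2).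
[cite: Zhang2022LandauSiegel, (10.6), (10.2)] -/
theorem tent_lin3 {Λ y : ℝ} (hy : 0 < y) :
    Real.log (Ppow Λ 0.504 / y) - 2 * Real.log (Ppow Λ 0.502 / y) + Real.log (Ppow Λ 0.5 / y) = 0 := by
  rw [log_Ppow_div hy, log_Ppow_div hy, log_Ppow_div hy]; ring

/-- Lemma 10.2, proof of (10.8): "the function `((P₁′)ˢ − 2(P₂′)ˢ + (P₃′)ˢ)s⁻²` is analytic and equal to
`(log P/500)²` at `s = 0`" — the quadratic tent identity
`½(log²(P₁′/y) − 2log²(P₂′/y) + log²(P₃′/y)) = (log P/500)²` (independently of `y`), from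
`0.504² − 2·0.502² + 0.5² = 2·0.002²`. [cite: Zhang2022LandauSiegel, Lemma 10.2 (proof of (10.8))] -/
theorem tent_sq3 {Λ y : ℝ} (hy : 0 < y) :
    (Real.log (Ppow Λ 0.504 / y) ^ 2 - 2 * Real.log (Ppow Λ 0.502 / y) ^ 2
        + Real.log (Ppow Λ 0.5 / y) ^ 2) / 2 = (Λ / 500) ^ 2 := by
  rw [log_Ppow_div hy, log_Ppow_div hy, log_Ppow_div hy]; ring

/-! ### `𝔶₁ⱼ`, `𝔶₂ⱼ` (Lemma 10.2) and Lemmas 10.1/10.2 in the manuscript's variables -/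

/-- Lemma 10.2: `𝔶₁ⱼ(y) = (β_{j+1} + β_{j+2})log(y/P^{0.5}) + ½β_{j+1}β_{j+2}(log²(P^{0.504}/y) − 2log²(P^{0.502}/y))`,
as a function of the two shifts, `Λ = log P` and real `y > 0`. [cite: Zhang2022LandauSiegel, Lemma 10.2, (10.9)] -/
def yfrak1 (β1 β2 : ℂ) (Λ y : ℝ) : ℂ :=
  (β1 + β2) * (Real.log (y / Ppow Λ 0.5) : ℂ)
    + β1 * β2 / 2 * ((Real.log (Ppow Λ 0.504 / y) ^ 2 - 2 * Real.log (Ppow Λ 0.502 / y) ^ 2 : ℝ) : ℂ)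

/-- Lemma 10.2: `𝔶₂ⱼ(y) = (β_{j+1} + β_{j+2})log(P^{0.504}/y) + ½β_{j+1}β_{j+2}log²(P^{0.504}/y)`.
[cite: Zhang2022LandauSiegel, Lemma 10.2, (10.10)] -/
def yfrak2 (β1 β2 : ℂ) (Λ y : ℝ) : ℂ :=
  (β1 + β2) * (Real.log (Ppow Λ 0.504 / y) : ℂ)
    + β1 * β2 / 2 * ((Real.log (Ppow Λ 0.504 / y) ^ 2 : ℝ) : ℂ)

/-- **Lemma 10.1, (10.3)** (`P^{0.5} < y ≤ P^{0.502}/T`): on any circle around `0`,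
`(2πi)⁻¹ ∮ ((P₁′)ˢ − 2(P₂′)ˢ) y⁻ˢ (s − β_j) s⁻² ds = −1 − β_j log(y/P^{0.5})` (`xˢ := e^{s log x}`; the
manuscript's circle is `|s| = 5α` and the displayed main term is `(500L′(1,χ)/log P)` times this).
[cite: Zhang2022LandauSiegel, Lemma 10.1, (10.3)] -/
theorem lemma101_range2 (β : ℂ) {Λ y : ℝ} (hy : 0 < y) {c : ℂ} {R : ℝ} (h0 : (0 : ℂ) ∈ ball c R) :
    (2 * π * I)⁻¹ * (∮ s in C(c, R),
        texp2 (Real.log (Ppow Λ 0.504 / y)) (Real.log (Ppow Λ 0.502 / y)) s * (s - β) / s ^ 2)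
      = -1 - β * Real.log (y / Ppow Λ 0.5) := by
  rw [lemma101_residue2 _ _ _ h0, ← tent_lin2 hy]; push_cast; ring

/-- **Lemma 10.1, (10.4)** (`P^{0.502} < y ≤ P^{0.504}/T`):
`(2πi)⁻¹ ∮ (P₁′/y)ˢ (s − β_j) s⁻² ds = 1 − β_j log(P^{0.504}/y)`.
[cite: Zhang2022LandauSiegel, Lemma 10.1, (10.4)] -/
theorem lemma101_range3 (β : ℂ) (Λ y : ℝ) {c : ℂ} {R : ℝ} (h0 : (0 : ℂ) ∈ ball c R) :
    (2 * π * I)⁻¹ * (∮ s in C(c, R), texp1 (Real.log (Ppow Λ 0.504 / y)) s * (s - β) / s ^ 2)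
      = 1 - β * Real.log (Ppow Λ 0.504 / y) :=
  lemma101_residue1 _ _ h0

/-- **Lemma 10.1 / (10.6)** (`y ≤ P^{0.5}`): with all three terms the residue at `0` vanishes
(`tent_lin3`); the manuscript bounds this range by `T^{-c}` via Pólya–Vinogradov instead ((10.2)).
[cite: Zhang2022LandauSiegel, Lemma 10.1, (10.2), (10.6)] -/
theorem lemma101_range1 (β : ℂ) {Λ y : ℝ} (hy : 0 < y) {c : ℂ} {R : ℝ} (h0 : (0 : ℂ) ∈ ball c R) :
    (2 * π * I)⁻¹ * (∮ s in C(c, R),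
        texp3 (Real.log (Ppow Λ 0.504 / y)) (Real.log (Ppow Λ 0.502 / y))
          (Real.log (Ppow Λ 0.5 / y)) s * (s - β) / s ^ 2) = 0 := by
  rw [lemma101_residue3 _ _ _ _ h0]
  have := tent_lin3 (Λ := Λ) hy
  rw [← Complex.ofReal_inj] at this
  push_cast at this
  rw [this, mul_zero]

/-- **Lemma 10.2, (10.8)** (`dr ≤ P^{0.5}/T`): on any circle around `0`,
`(2πi)⁻¹ ∮ (β_{j+1} + s)(β_{j+2} + s) s⁻¹ ((P₁′)ˢ − 2(P₂′)ˢ + (P₃′)ˢ)(dr)⁻ˢ s⁻² ds = β_{j+1}β_{j+2}(log P/500)²`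
(so that, times the prefactor `500L′(1,χ)Π(d,r)/log P`, the main term is
`(L′(1,χ)Π(d,r)/500)β_{j+1}β_{j+2}log P` as printed; the manuscript's circle is `|s| = 10α`).
[cite: Zhang2022LandauSiegel, Lemma 10.2, (10.8)] -/
theorem lemma102_range1 (β1 β2 : ℂ) {Λ y : ℝ} (hy : 0 < y) {c : ℂ} {R : ℝ}
    (h0 : (0 : ℂ) ∈ ball c R) :
    (2 * π * I)⁻¹ * (∮ s in C(c, R), (β1 + s) * (β2 + s) / s
        * texp3 (Real.log (Ppow Λ 0.504 / y)) (Real.log (Ppow Λ 0.502 / y))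
            (Real.log (Ppow Λ 0.5 / y)) s / s ^ 2)
      = β1 * β2 * (((Λ / 500) ^ 2 : ℝ) : ℂ) := by
  rw [lemma102_residue3 _ _ _ _ _ h0, ← tent_sq3 (Λ := Λ) hy]
  have := tent_lin3 (Λ := Λ) hy
  rw [← Complex.ofReal_inj] at this
  push_cast at this ⊢
  rw [this]; ring

/-- The prefactor bookkeeping of (10.8): `(500/log P)·β₁β₂(log P/500)² = β₁β₂ log P/500`.
[cite: Zhang2022LandauSiegel, (10.8)] -/
theorem prefactor_108 (β1 β2 : ℂ) {Λ : ℝ} (hΛ : Λ ≠ 0) :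
    ((500 / Λ : ℝ) : ℂ) * (β1 * β2 * (((Λ / 500) ^ 2 : ℝ) : ℂ)) = β1 * β2 * Λ / 500 := by
  have : (Λ : ℂ) ≠ 0 := by exact_mod_cast hΛ
  push_cast; field_simp

/-- **Lemma 10.2, (10.9)** (`P^{0.5} < dr ≤ P^{0.502}/T`, `y = dr`):
`(2πi)⁻¹ ∮ (β_{j+1} + s)(β_{j+2} + s) s⁻¹ ((P₁′)ˢ − 2(P₂′)ˢ) y⁻ˢ s⁻² ds = −1 + 𝔶₁ⱼ(y)`.
[cite: Zhang2022LandauSiegel, Lemma 10.2, (10.9)] -/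
theorem lemma102_range2 (β1 β2 : ℂ) {Λ y : ℝ} (hy : 0 < y) {c : ℂ} {R : ℝ}
    (h0 : (0 : ℂ) ∈ ball c R) :
    (2 * π * I)⁻¹ * (∮ s in C(c, R), (β1 + s) * (β2 + s) / s
        * texp2 (Real.log (Ppow Λ 0.504 / y)) (Real.log (Ppow Λ 0.502 / y)) s / s ^ 2)
      = -1 + yfrak1 β1 β2 Λ y := by
  rw [lemma102_residue2 _ _ _ _ h0, yfrak1, ← tent_lin2 hy]; push_cast; ring

/-- **Lemma 10.2, (10.10)** (`P^{0.502} < dr ≤ P^{0.504}/T`):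
`(2πi)⁻¹ ∮ (β_{j+1} + s)(β_{j+2} + s) s⁻¹ (P₁′/y)ˢ s⁻² ds = 1 + 𝔶₂ⱼ(y)`.
[cite: Zhang2022LandauSiegel, Lemma 10.2, (10.10)] -/
theorem lemma102_range3 (β1 β2 : ℂ) (Λ y : ℝ) {c : ℂ} {R : ℝ} (h0 : (0 : ℂ) ∈ ball c R) :
    (2 * π * I)⁻¹ * (∮ s in C(c, R), (β1 + s) * (β2 + s) / s
        * texp1 (Real.log (Ppow Λ 0.504 / y)) s / s ^ 2)
      = 1 + yfrak2 β1 β2 Λ y := by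
  rw [lemma102_residue1 _ _ _ h0, yfrak2]; push_cast; ring

/-! ### Main values: `β_j log P^{u} → jπiu`, `𝔶_{μj}(Pᶻ) → 𝔶𝔶_{μj}(z)` -/

section MainValues

variable {α Λ : ℝ}

/-- "By direct calculation, for `0 ≤ z ≤ 1` we have `β_j log P^{z−0.5} = πij(z − 0.5) + O(ℒ⁻⁸)`,
`β_j log P^{0.504−z} = πij(0.504 − z) + O(ℒ⁻⁸)`": at the main value `β_j⁰ = jiα` and with
`α log P = π` both hold EXACTLY, in the general form `β_j⁰ log(Pᵃ/Pᵇ) = πij(a − b)`.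
[cite: Zhang2022LandauSiegel, §10, display after Lemma 10.2] -/
theorem betaMain_mul_log (h : α * Λ = π) (j : ℚ) (a b : ℝ) :
    betaMain j α * (Real.log (Ppow Λ a / Ppow Λ b) : ℂ) = (j : ℂ) * π * I * ((a : ℂ) - b) := by
  have hπ : (π : ℂ) = (α : ℂ) * Λ := by rw [← Complex.ofReal_mul, h]
  rw [log_Ppow_div_Ppow]
  unfold betaMain
  rw [hπ]; push_cast; ring

/-- `𝔶₁ⱼ(Pᶻ) = 𝔶𝔶₁ⱼ(z) + O(ℒ⁻⁸)`: EXACT at the main values, in the generic form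
`𝔶₁(Pᶻ) = yy1F (b₁ + b₂) (−b₁b₂/2) z` for `(β_{j+1}, β_{j+2}) = (b₁iα, b₂iα)`, `α log P = π`
(so `(s, h) = (5, −3), (4, −3/2), (3, −1)` for `(b₁, b₂) = (2, 3), (3, 1), (1, 2)`, i.e. `j = 1, 2, 3`
under `β₄ = β₁, β₅ = β₂`). [cite: Zhang2022LandauSiegel, §10, display after Lemma 10.2] -/
theorem yfrak1_main (h : α * Λ = π) (b1 b2 : ℚ) (z : ℝ) :
    yfrak1 (betaMain b1 α) (betaMain b2 α) Λ (Ppow Λ z) = yy1F (b1 + b2) (-(b1 * b2) / 2) z := by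
  have hπ : (π : ℂ) = (α : ℂ) * Λ := by rw [← Complex.ofReal_mul, h]
  unfold yfrak1 yy1F betaMain
  rw [log_Ppow_div_Ppow, log_Ppow_div_Ppow, log_Ppow_div_Ppow]
  rw [hπ]; push_cast
  have hI : I * I = -1 := I_mul_I
  linear_combination ((b1 : ℂ) * b2 * α ^ 2 * Λ ^ 2
    * ((0.504 - (z : ℂ)) ^ 2 - 2 * (0.502 - (z : ℂ)) ^ 2) / 2) * hI

/-- `𝔶₂ⱼ(Pᶻ) = 𝔶𝔶₂ⱼ(z)`: EXACT at the main values, `𝔶₂(Pᶻ) = yy2F (b₁ + b₂) (−b₁b₂/2) z`.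
[cite: Zhang2022LandauSiegel, §10, display after Lemma 10.2] -/
theorem yfrak2_main (h : α * Λ = π) (b1 b2 : ℚ) (z : ℝ) :
    yfrak2 (betaMain b1 α) (betaMain b2 α) Λ (Ppow Λ z) = yy2F (b1 + b2) (-(b1 * b2) / 2) z := by
  have hπ : (π : ℂ) = (α : ℂ) * Λ := by rw [← Complex.ofReal_mul, h]
  unfold yfrak2 yy2F betaMain
  rw [log_Ppow_div_Ppow]
  rw [hπ]; push_cast
  have hI : I * I = -1 := I_mul_I
  linear_combination ((b1 : ℂ) * b2 * α ^ 2 * Λ ^ 2 * (0.504 - (z : ℂ)) ^ 2 / 2) * hI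

/-- `𝔶₁₁(Pᶻ) = 𝔶𝔶₁₁(z)` (`j = 1`: `(β₂, β₃)`). [cite: Zhang2022LandauSiegel, §10 after Lemma 10.2] -/
theorem yfrak1_main_1 (h : α * Λ = π) (z : ℝ) :
    yfrak1 (betaMain 2 α) (betaMain 3 α) Λ (Ppow Λ z) = yy11 z := by
  rw [yfrak1_main h, yy11]; norm_num
/-- `𝔶₁₂(Pᶻ) = 𝔶𝔶₁₂(z)` (`j = 2`: `(β₃, β₄) = (β₃, β₁)`). [cite: Zhang2022LandauSiegel, §10 after Lemma 10.2] -/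
theorem yfrak1_main_2 (h : α * Λ = π) (z : ℝ) :
    yfrak1 (betaMain 3 α) (betaMain 1 α) Λ (Ppow Λ z) = yy12 z := by
  rw [yfrak1_main h, yy12]; norm_num
/-- `𝔶₁₃(Pᶻ) = 𝔶𝔶₁₃(z)` (`j = 3`: `(β₄, β₅) = (β₁, β₂)`). [cite: Zhang2022LandauSiegel, §10 after Lemma 10.2] -/
theorem yfrak1_main_3 (h : α * Λ = π) (z : ℝ) :
    yfrak1 (betaMain 1 α) (betaMain 2 α) Λ (Ppow Λ z) = yy13 z := by
  rw [yfrak1_main h, yy13]; norm_num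
/-- `𝔶₂₁(Pᶻ) = 𝔶𝔶₂₁(z)`. [cite: Zhang2022LandauSiegel, §10 after Lemma 10.2] -/
theorem yfrak2_main_1 (h : α * Λ = π) (z : ℝ) :
    yfrak2 (betaMain 2 α) (betaMain 3 α) Λ (Ppow Λ z) = yy21 z := by
  rw [yfrak2_main h, yy21]; norm_num
/-- `𝔶₂₂(Pᶻ) = 𝔶𝔶₂₂(z)`. [cite: Zhang2022LandauSiegel, §10 after Lemma 10.2] -/
theorem yfrak2_main_2 (h : α * Λ = π) (z : ℝ) :
    yfrak2 (betaMain 3 α) (betaMain 1 α) Λ (Ppow Λ z) = yy22 z := by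
  rw [yfrak2_main h, yy22]; norm_num
/-- `𝔶₂₃(Pᶻ) = 𝔶𝔶₂₃(z)`. [cite: Zhang2022LandauSiegel, §10 after Lemma 10.2] -/
theorem yfrak2_main_3 (h : α * Λ = π) (z : ℝ) :
    yfrak2 (betaMain 1 α) (betaMain 2 α) Λ (Ppow Λ z) = yy23 z := by
  rw [yfrak2_main h, yy23]; norm_num

end MainValues

/-! ## Part B. "Substituting `x = Pᶻ`": from Lemmas 10.1–10.2 to the printed `d`-constants

Conventions (as in `Section8ChangeOfVariables`, `Section9ChangeOfVariables`): `Λ = log P > 0`,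
`α log P = π` ((2.9) at main order), `P^θ := Ppow Λ θ = e^{θΛ}`; the scales are idealised to pure powers
of `P` (`P₂ = P^{0.5}`, `P₃ = P^{0.498}`, breakpoints `P^{0.496}, …, P^{0.504}`: the `/T`, `Dt₀` and `α̃`
windows are `o(α)` by (10.5), (10.11) and are dropped, as in the manuscript's displayed integrals); the
§8 rule `Σₙ |χ(n)|λ₀ⱼ(n)φ(n)⁻¹ g(n) → (𝔞/L′(1,χ)²)∫ g(x) dx/x` is applied formally (we start from the
`∫ … dx/x` expressions, normalised by `𝔞`), and the profiles are abstract functions `F(P^z) = f(z)`. -/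

section PartB

variable {α Λ : ℝ}

/-- `Pᵃ/Pᵇ = P^{a−b}`. [folklore] -/
theorem Ppow_div_Ppow' (Λ a b : ℝ) : Ppow Λ a / Ppow Λ b = Ppow Λ (a - b) := Ppow_div_Ppow Λ a b

/-- `PᵃPᵇ = P^{a+b}`. [folklore] -/
theorem Ppow_mul_Ppow (Λ a b : ℝ) : Ppow Λ a * Ppow Λ b = Ppow Λ (a + b) := by
  unfold Ppow; rw [← Real.exp_add]; congr 1; ring

/-- `∫_{Pᵃ}^{Pᵇ} Φ(x) dx/x = log P · ∫ₐᵇ Φ(Pᶻ) dz` (`log P = Λ ≥ 0`). [folklore] -/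
theorem integral_Ppow_Ppow {Λ : ℝ} (hΛ : 0 ≤ Λ) (a b : ℝ) (Φ : ℝ → ℂ) :
    ∫ x in Ppow Λ a..Ppow Λ b, Φ x / x = (Λ : ℂ) * ∫ z in a..b, Φ (Ppow Λ z) :=
  (integral_comp_exp_mul hΛ Φ).symm

/-- `∫₁^{Pᵇ} Φ(x) dx/x = log P · ∫₀ᵇ Φ(Pᶻ) dz`. [folklore] -/
theorem integral_one_Ppow' {Λ : ℝ} (hΛ : 0 ≤ Λ) (b : ℝ) (Φ : ℝ → ℂ) :
    ∫ x in (1:ℝ)..Ppow Λ b, Φ x / x = (Λ : ℂ) * ∫ z in (0:ℝ)..b, Φ (Ppow Λ z) :=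
  integral_one_Ppow hΛ b Φ

/-- `∫₀ᶜ g(c − z) dz = ∫₀ᶜ g(z) dz`. [folklore] -/
theorem integral_reflect (g : ℝ → ℂ) (c : ℝ) :
    ∫ z in (0:ℝ)..c, g (c - z) = ∫ z in (0:ℝ)..c, g z := by
  rw [intervalIntegral.integral_comp_sub_left g c, sub_self, sub_zero]

/-- `∫(f₁ + f₂) = ∫f₁ + ∫f₂` for continuous integrands. [folklore] -/
theorem integral_add2 {a b : ℝ} {f1 f2 : ℝ → ℂ} (h1 : Continuous f1) (h2 : Continuous f2) :
    ∫ x in a..b, (f1 x + f2 x) = (∫ x in a..b, f1 x) + ∫ x in a..b, f2 x :=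
  intervalIntegral.integral_add (h1.intervalIntegrable _ _) (h2.intervalIntegrable _ _)

/-- `∫(f₁ − f₂) = ∫f₁ − ∫f₂` for continuous integrands. [folklore] -/
theorem integral_sub2 {a b : ℝ} {f1 f2 : ℝ → ℂ} (h1 : Continuous f1) (h2 : Continuous f2) :
    ∫ x in a..b, (f1 x - f2 x) = (∫ x in a..b, f1 x) - ∫ x in a..b, f2 x :=
  intervalIntegral.integral_sub (h1.intervalIntegrable _ _) (h2.intervalIntegrable _ _)

/-- `∫(f₁ + f₂ + f₃) = ∫f₁ + ∫f₂ + ∫f₃` for continuous integrands. [folklore] -/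
theorem integral_add3 {a b : ℝ} {f1 f2 f3 : ℝ → ℂ} (h1 : Continuous f1) (h2 : Continuous f2)
    (h3 : Continuous f3) :
    ∫ x in a..b, (f1 x + f2 x + f3 x)
      = (∫ x in a..b, f1 x) + (∫ x in a..b, f2 x) + ∫ x in a..b, f3 x := by
  have h12 : Continuous fun x => f1 x + f2 x := h1.add h2
  rw [intervalIntegral.integral_add (h12.intervalIntegrable _ _) (h3.intervalIntegrable _ _),
    intervalIntegral.integral_add (h1.intervalIntegrable _ _) (h2.intervalIntegrable _ _)]

/-- `∫(f₁ + f₂ + f₃ + f₄) = ∫f₁ + ∫f₂ + ∫f₃ + ∫f₄` for continuous integrands. [folklore] -/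
theorem integral_add4 {a b : ℝ} {f1 f2 f3 f4 : ℝ → ℂ} (h1 : Continuous f1) (h2 : Continuous f2)
    (h3 : Continuous f3) (h4 : Continuous f4) :
    ∫ x in a..b, (f1 x + f2 x + f3 x + f4 x)
      = (∫ x in a..b, f1 x) + (∫ x in a..b, f2 x) + (∫ x in a..b, f3 x) + ∫ x in a..b, f4 x := by
  have h12 : Continuous fun x => f1 x + f2 x := h1.add h2
  have h123 : Continuous fun x => f1 x + f2 x + f3 x := h12.add h3
  rw [intervalIntegral.integral_add (h123.intervalIntegrable _ _) (h4.intervalIntegrable _ _),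
    intervalIntegral.integral_add (h12.intervalIntegrable _ _) (h3.intervalIntegrable _ _),
    intervalIntegral.integral_add (h1.intervalIntegrable _ _) (h2.intervalIntegrable _ _)]

/-! ### `Θ₁(a₁₁, a₁₃)`: the passage to `d₃ⱼ` ((10.12)) -/

/-- The three displayed range contributions to `S_j(a₁₁,a₁₃)/𝔞` (proof of (10.12)), at the level
`Σₙ|χ(n)|λ₀ⱼ(n)φ(n)⁻¹(…) → (𝔞/L′²)∫(…)dx/x`, with abstract profiles `𝔣_{j6} = F6`, `𝔣_{j7} = F7`,
`𝔶₁ⱼ = Y1`, `𝔶₂ⱼ = Y2`, `κ = β_{j+1}β_{j+2}` and `Λ = log P`: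
`(κ/500)∫₁^{P^{0.5}}(𝔣_{j6}(P^{0.504}/x)/0.504 + ι₂𝔣_{j7}(P^{0.5}/x)/0.5)dx/x`
`+ (500/(0.504 log²P))∫_{P^{0.5}}^{P^{0.502}} 𝔣_{j6}(P^{0.504}/x)(−1 + 𝔶₁ⱼ(x))dx/x`
`+ (500/(0.504 log²P))∫_{P^{0.502}}^{P^{0.504}} 𝔣_{j6}(P^{0.504}/x)(1 + 𝔶₂ⱼ(x))dx/x`
(Lemma 10.2 (10.8)–(10.10) times the `λ₁₁` main term of §8).
[cite: Zhang2022LandauSiegel, §10, proof of (10.12)] -/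
def S1113 (F6 F7 Y1 Y2 : ℝ → ℂ) (κ : ℂ) (Λ : ℝ) : ℂ :=
  κ / 500 * (∫ x in (1:ℝ)..Ppow Λ 0.5,
      (F6 (Ppow Λ 0.504 / x) / 0.504 + iota2 * F7 (Ppow Λ 0.5 / x) / 0.5) / x)
    + 500 / (0.504 * (Λ : ℂ) ^ 2) * (∫ x in Ppow Λ 0.5..Ppow Λ 0.502,
      F6 (Ppow Λ 0.504 / x) * (-1 + Y1 x) / x)
    + 500 / (0.504 * (Λ : ℂ) ^ 2) * (∫ x in Ppow Λ 0.502..Ppow Λ 0.504,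
      F6 (Ppow Λ 0.504 / x) * (1 + Y2 x) / x)

/-- **`α⁻¹S_j(a₁₁,a₁₃)/𝔞 = d₃ⱼ` at main order**, for abstract profiles: if `F6(Pᶻ) = f6(z)`,
`F7(Pᶻ) = f7(z)`, `Y1(Pᶻ) = y1(z)`, `Y2(Pᶻ) = y2(z)`, `κ log P = −nπα` ("`β_{j+1}β_{j+2}log P =
−(11 − 6j + j²)πα + o(α)`") and `α log P = π`, then `α⁻¹·S1113 = d3F n f6 f7 y1 y2` — the substitution
`x = Pᶻ`, the reflection `z ↦ 0.5 − z` in the first range, and `u = 0.504 − z`, `u = 0.002 + v` for the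
constant parts of the other two (`∫_{0.502}^{0.504}𝔣𝔣(0.504−z) − ∫_{0.5}^{0.502}𝔣𝔣(0.504−z)
= ∫₀^{0.002}(𝔣𝔣(z) − 𝔣𝔣(0.002+z))`). [cite: Zhang2022LandauSiegel, §10, proof of (10.12)] -/
theorem S1113_eq_d3F (hα : 0 < α) (hΛ : 0 < Λ) (h : α * Λ = π)
    {F6 F7 Y1 Y2 f6 f7 y1 y2 : ℝ → ℂ} (hf6 : Continuous f6) (hy1 : Continuous y1)
    (hy2 : Continuous y2)
    (e6 : ∀ z, F6 (Ppow Λ z) = f6 z) (e7 : ∀ z, F7 (Ppow Λ z) = f7 z)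
    (ey1 : ∀ z, Y1 (Ppow Λ z) = y1 z) (ey2 : ∀ z, Y2 (Ppow Λ z) = y2 z)
    {κ : ℂ} {n : ℕ} (hκ : κ * Λ = -((n : ℂ) * π * α)) :
    1 / (α : ℂ) * S1113 F6 F7 Y1 Y2 κ Λ = d3F n f6 f7 y1 y2 := by
  have hΛ0 : (Λ : ℂ) ≠ 0 := by exact_mod_cast hΛ.ne'
  have hα0 : (α : ℂ) ≠ 0 := by exact_mod_cast hα.ne'
  have hπ : (π : ℂ) = (α : ℂ) * Λ := by rw [← Complex.ofReal_mul, h]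
  have hκ' : κ = -((n : ℂ) * π * α) / Λ := by rw [← hκ, mul_div_cancel_right₀ _ hΛ0]
  -- `x = Pᶻ` in the three ranges
  have R1 : (∫ x in (1:ℝ)..Ppow Λ 0.5,
        (F6 (Ppow Λ 0.504 / x) / 0.504 + iota2 * F7 (Ppow Λ 0.5 / x) / 0.5) / x)
      = (Λ : ℂ) * ∫ z in (0:ℝ)..0.5,
          (f6 (0.004 + (0.5 - z)) / 0.504 + iota2 * f7 (0.5 - z) / 0.5) := by
    rw [integral_one_Ppow' hΛ.le 0.5
        (fun x => F6 (Ppow Λ 0.504 / x) / 0.504 + iota2 * F7 (Ppow Λ 0.5 / x) / 0.5),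
      intervalIntegral.integral_congr
        (g := fun z => f6 (0.004 + (0.5 - z)) / 0.504 + iota2 * f7 (0.5 - z) / 0.5)
        fun z _ => by
          have hz : (0.504 : ℝ) - z = 0.004 + (0.5 - z) := by ring
          simp only [Ppow_div_Ppow', e6, e7, hz]]
  have R2 : (∫ x in Ppow Λ 0.5..Ppow Λ 0.502, F6 (Ppow Λ 0.504 / x) * (-1 + Y1 x) / x)
      = (Λ : ℂ) * ∫ z in (0.5:ℝ)..0.502, f6 (0.504 - z) * (-1 + y1 z) := by
    rw [integral_Ppow_Ppow hΛ.le 0.5 0.502 (fun x => F6 (Ppow Λ 0.504 / x) * (-1 + Y1 x)),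
      intervalIntegral.integral_congr (g := fun z => f6 (0.504 - z) * (-1 + y1 z))
        fun z _ => by simp only [Ppow_div_Ppow', e6, ey1]]
  have R3 : (∫ x in Ppow Λ 0.502..Ppow Λ 0.504, F6 (Ppow Λ 0.504 / x) * (1 + Y2 x) / x)
      = (Λ : ℂ) * ∫ z in (0.502:ℝ)..0.504, f6 (0.504 - z) * (1 + y2 z) := by
    rw [integral_Ppow_Ppow hΛ.le 0.502 0.504 (fun x => F6 (Ppow Λ 0.504 / x) * (1 + Y2 x)),
      intervalIntegral.integral_congr (g := fun z => f6 (0.504 - z) * (1 + y2 z))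
        fun z _ => by simp only [Ppow_div_Ppow', e6, ey2]]
  -- `z ↦ 0.5 − z` in the first range
  have Z1 : (∫ z in (0:ℝ)..0.5, (f6 (0.004 + (0.5 - z)) / 0.504 + iota2 * f7 (0.5 - z) / 0.5))
      = ∫ z in (0:ℝ)..0.5, (((1 / 0.504 : ℝ) : ℂ) * f6 (0.004 + z) + iota2 / 0.5 * f7 z) := by
    rw [integral_reflect (fun u => f6 (0.004 + u) / 0.504 + iota2 * f7 u / 0.5) 0.5]
    refine intervalIntegral.integral_congr fun z _ => ?_
    push_cast
    ring
  -- the constant parts of the second and third ranges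
  have Z2 : (∫ z in (0.5:ℝ)..0.502, f6 (0.504 - z) * (-1 + y1 z))
      = -(∫ z in (0:ℝ)..0.002, f6 (0.002 + z))
          + ∫ z in (0.5:ℝ)..0.502, f6 (0.504 - z) * y1 z := by
    have i1 : IntervalIntegrable (fun z => -f6 (0.504 - z)) volume (0.5:ℝ) 0.502 :=
      (by fun_prop : Continuous fun z => -f6 (0.504 - z)).intervalIntegrable _ _
    have i2 : IntervalIntegrable (fun z => f6 (0.504 - z) * y1 z) volume (0.5:ℝ) 0.502 :=
      (by fun_prop : Continuous fun z => f6 (0.504 - z) * y1 z).intervalIntegrable _ _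
    have s : (∫ z in (0.5:ℝ)..0.502, f6 (0.504 - z) * (-1 + y1 z))
        = (∫ z in (0.5:ℝ)..0.502, -f6 (0.504 - z))
            + ∫ z in (0.5:ℝ)..0.502, f6 (0.504 - z) * y1 z := by
      rw [← intervalIntegral.integral_add i1 i2]
      refine intervalIntegral.integral_congr fun z _ => ?_
      ring
    have sh : (∫ z in (0.002:ℝ)..0.004, f6 z) = ∫ z in (0:ℝ)..0.002, f6 (0.002 + z) := by
      rw [intervalIntegral.integral_comp_add_left f6 0.002, add_zero,
        show (0.002:ℝ) + 0.002 = 0.004 by norm_num]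
    rw [s, intervalIntegral.integral_neg, intervalIntegral.integral_comp_sub_left f6 0.504,
      show (0.504:ℝ) - 0.502 = 0.002 by norm_num, show (0.504:ℝ) - 0.5 = 0.004 by norm_num, sh]
  have Z3 : (∫ z in (0.502:ℝ)..0.504, f6 (0.504 - z) * (1 + y2 z))
      = (∫ z in (0:ℝ)..0.002, f6 z) + ∫ z in (0.502:ℝ)..0.504, f6 (0.504 - z) * y2 z := by
    have i1 : IntervalIntegrable (fun z => f6 (0.504 - z)) volume (0.502:ℝ) 0.504 :=
      (by fun_prop : Continuous fun z => f6 (0.504 - z)).intervalIntegrable _ _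
    have i2 : IntervalIntegrable (fun z => f6 (0.504 - z) * y2 z) volume (0.502:ℝ) 0.504 :=
      (by fun_prop : Continuous fun z => f6 (0.504 - z) * y2 z).intervalIntegrable _ _
    have s : (∫ z in (0.502:ℝ)..0.504, f6 (0.504 - z) * (1 + y2 z))
        = (∫ z in (0.502:ℝ)..0.504, f6 (0.504 - z))
            + ∫ z in (0.502:ℝ)..0.504, f6 (0.504 - z) * y2 z := by
      rw [← intervalIntegral.integral_add i1 i2]
      refine intervalIntegral.integral_congr fun z _ => ?_
      ring
    rw [s, intervalIntegral.integral_comp_sub_left f6 0.504, sub_self,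
      show (0.504:ℝ) - 0.502 = 0.002 by norm_num]
  have D : (∫ z in (0:ℝ)..0.002, (f6 z - f6 (0.002 + z)))
      = (∫ z in (0:ℝ)..0.002, f6 z) - ∫ z in (0:ℝ)..0.002, f6 (0.002 + z) :=
    intervalIntegral.integral_sub (hf6.intervalIntegrable _ _)
      ((by fun_prop : Continuous fun z => f6 (0.002 + z)).intervalIntegrable _ _)
  unfold S1113 d3F
  rw [R1, R2, R3, Z1, Z2, Z3, D, hκ']
  generalize (∫ z in (0:ℝ)..0.5, (((1 / 0.504 : ℝ) : ℂ) * f6 (0.004 + z) + iota2 / 0.5 * f7 z)) = I1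
  generalize (∫ z in (0:ℝ)..0.002, f6 z) = J1
  generalize (∫ z in (0:ℝ)..0.002, f6 (0.002 + z)) = J2
  generalize (∫ z in (0.5:ℝ)..0.502, f6 (0.504 - z) * y1 z) = K1
  generalize (∫ z in (0.502:ℝ)..0.504, f6 (0.504 - z) * y2 z) = K2
  push_cast
  rw [hπ]
  field_simp
  ring

/-! ### `Θ₁(a₁₃, a₂₁)`: the passage to `d₄ⱼ` ((10.13)) -/

/-- The two displayed range contributions to `S_j(a₁₃,a₂₁)/𝔞` (proof of (10.13)), at the level
`Σₙ → (𝔞/L′²)∫dx/x`, with abstract profile `𝔤_{j6} = G6`, shift `β = β_j` and `Λ = log P`: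
`(500/(0.504 log²P))∫_{P^{0.5}}^{P^{0.502}}(−1 − β_j log(x/P^{0.5}))𝔤_{j6}(P^{0.504}/x)dx/x`
`+ (500/(0.504 log²P))∫_{P^{0.502}}^{P^{0.504}}(1 − β_j log(P^{0.504}/x))𝔤_{j6}(P^{0.504}/x)dx/x`
(Lemma 10.1 (10.3)–(10.4) times the `λ₂₁` main term of §8; the range `dr < P^{0.5}` "is `o(α)`" — its
residue vanishes, `lemma101_range1`). [cite: Zhang2022LandauSiegel, §10, proof of (10.13)] -/
def S1321 (G6 : ℝ → ℂ) (β : ℂ) (Λ : ℝ) : ℂ :=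
  500 / (0.504 * (Λ : ℂ) ^ 2) * (∫ x in Ppow Λ 0.5..Ppow Λ 0.502,
      (-1 - β * (Real.log (x / Ppow Λ 0.5) : ℂ)) * G6 (Ppow Λ 0.504 / x) / x)
    + 500 / (0.504 * (Λ : ℂ) ^ 2) * (∫ x in Ppow Λ 0.502..Ppow Λ 0.504,
      (1 - β * (Real.log (Ppow Λ 0.504 / x) : ℂ)) * G6 (Ppow Λ 0.504 / x) / x)

/-- **`α⁻¹S_j(a₁₃,a₂₁)/𝔞 = d₄ⱼ` at main order**, for an abstract profile: if `G6(Pᶻ) = g6(z)`,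
`β log P = jπi` (`β_j = jiα` and `α log P = π`), then `α⁻¹·S1321 = d4F j g6` — the substitution `x = Pᶻ`
("`β_j log P^{z−0.5} = πij(z − 0.5)`, `β_j log P^{0.504−z} = πij(0.504 − z)`"), then `u = 0.504 − z`
(and `u = 0.002 + v` on the second range): `∫_{0.5}^{0.502}(−1 − πij(z − 0.5))𝔤𝔥(0.504 − z)dz
= −∫₀^{0.002}𝔤𝔥(0.002 + v)dv − πij∫₀^{0.002}(0.002 − v)𝔤𝔥(0.002 + v)dv`,
`∫_{0.502}^{0.504}(1 − πij(0.504 − z))𝔤𝔥(0.504 − z)dz = ∫₀^{0.002}𝔤𝔥 − πij∫₀^{0.002}u𝔤𝔥(u)du`.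
[cite: Zhang2022LandauSiegel, §10, proof of (10.13)] -/
theorem S1321_eq_d4F (hα : 0 < α) (hΛ : 0 < Λ) (h : α * Λ = π)
    {G6 g6 : ℝ → ℂ} (hg6 : Continuous g6) (e6 : ∀ z, G6 (Ppow Λ z) = g6 z)
    {β : ℂ} {j : ℕ} (hβ : β * Λ = (j : ℂ) * π * I) :
    1 / (α : ℂ) * S1321 G6 β Λ = d4F j g6 := by
  have hΛ0 : (Λ : ℂ) ≠ 0 := by exact_mod_cast hΛ.ne'
  have hα0 : (α : ℂ) ≠ 0 := by exact_mod_cast hα.ne'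
  have hπ : (π : ℂ) = (α : ℂ) * Λ := by rw [← Complex.ofReal_mul, h]
  have hβ' : β = (j : ℂ) * π * I / Λ := by rw [← hβ, mul_div_cancel_right₀ _ hΛ0]
  -- `x = Pᶻ`
  have R2 : (∫ x in Ppow Λ 0.5..Ppow Λ 0.502,
        (-1 - β * (Real.log (x / Ppow Λ 0.5) : ℂ)) * G6 (Ppow Λ 0.504 / x) / x)
      = (Λ : ℂ) * ∫ z in (0.5:ℝ)..0.502,
          (-1 - (j : ℂ) * π * I * (((0.004 - (0.504 - z) : ℝ)) : ℂ)) * g6 (0.504 - z) := by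
    rw [integral_Ppow_Ppow hΛ.le 0.5 0.502
        (fun x => (-1 - β * (Real.log (x / Ppow Λ 0.5) : ℂ)) * G6 (Ppow Λ 0.504 / x)),
      intervalIntegral.integral_congr
        (g := fun z => (-1 - (j : ℂ) * π * I * (((0.004 - (0.504 - z) : ℝ)) : ℂ)) * g6 (0.504 - z))
        fun z _ => by
          simp only [Ppow_div_Ppow', e6, log_Ppow]
          rw [hβ']; push_cast; field_simp; ring]
  have R3 : (∫ x in Ppow Λ 0.502..Ppow Λ 0.504,
        (1 - β * (Real.log (Ppow Λ 0.504 / x) : ℂ)) * G6 (Ppow Λ 0.504 / x) / x)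
      = (Λ : ℂ) * ∫ z in (0.502:ℝ)..0.504,
          (1 - (j : ℂ) * π * I * (((0.504 - z : ℝ)) : ℂ)) * g6 (0.504 - z) := by
    rw [integral_Ppow_Ppow hΛ.le 0.502 0.504
        (fun x => (1 - β * (Real.log (Ppow Λ 0.504 / x) : ℂ)) * G6 (Ppow Λ 0.504 / x)),
      intervalIntegral.integral_congr
        (g := fun z => (1 - (j : ℂ) * π * I * (((0.504 - z : ℝ)) : ℂ)) * g6 (0.504 - z))
        fun z _ => by
          simp only [Ppow_div_Ppow', e6, log_Ppow]
          rw [hβ']; push_cast; field_simp]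
  -- second range: `u = 0.504 − z`, `u = 0.002 + v`, split
  have Z2 : (∫ z in (0.5:ℝ)..0.502,
        (-1 - (j : ℂ) * π * I * (((0.004 - (0.504 - z) : ℝ)) : ℂ)) * g6 (0.504 - z))
      = -(∫ z in (0:ℝ)..0.002, g6 (0.002 + z))
        - (j : ℂ) * π * I * ∫ z in (0:ℝ)..0.002, g6 (0.002 + z) * (((0.002 - z : ℝ)) : ℂ) := by
    rw [intervalIntegral.integral_comp_sub_left
        (fun u => (-1 - (j : ℂ) * π * I * (((0.004 - u : ℝ)) : ℂ)) * g6 u) 0.504,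
      show (0.504:ℝ) - 0.502 = 0.002 by norm_num, show (0.504:ℝ) - 0.5 = 0.004 by norm_num]
    have t := intervalIntegral.integral_comp_add_left
      (fun u => (-1 - (j : ℂ) * π * I * (((0.004 - u : ℝ)) : ℂ)) * g6 u) (0.002:ℝ)
      (a := 0) (b := 0.002)
    rw [add_zero, show (0.002:ℝ) + 0.002 = 0.004 by norm_num] at t
    rw [← t]
    have i1 : IntervalIntegrable (fun v => -g6 (0.002 + v)) volume (0:ℝ) 0.002 :=
      (by fun_prop : Continuous fun v => -g6 (0.002 + v)).intervalIntegrable _ _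
    have i2 : IntervalIntegrable
        (fun v => (j : ℂ) * π * I * (g6 (0.002 + v) * (((0.002 - v : ℝ)) : ℂ))) volume (0:ℝ) 0.002 :=
      (by fun_prop : Continuous
        fun v => (j : ℂ) * π * I * (g6 (0.002 + v) * (((0.002 - v : ℝ)) : ℂ))).intervalIntegrable _ _
    rw [← intervalIntegral.integral_const_mul, ← intervalIntegral.integral_neg,
      ← intervalIntegral.integral_sub i1 i2]
    exact intervalIntegral.integral_congr fun v _ => by push_cast; ring
  -- third range: `u = 0.504 − z`, split
  have Z3 : (∫ z in (0.502:ℝ)..0.504, (1 - (j : ℂ) * π * I * (((0.504 - z : ℝ)) : ℂ)) * g6 (0.504 - z))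
      = (∫ z in (0:ℝ)..0.002, g6 z) - (j : ℂ) * π * I * ∫ z in (0:ℝ)..0.002, g6 z * (z : ℂ) := by
    rw [intervalIntegral.integral_comp_sub_left
        (fun u => (1 - (j : ℂ) * π * I * ((u : ℝ) : ℂ)) * g6 u) 0.504,
      sub_self, show (0.504:ℝ) - 0.502 = 0.002 by norm_num]
    have i1 : IntervalIntegrable (fun u => g6 u) volume (0:ℝ) 0.002 := hg6.intervalIntegrable _ _
    have i2 : IntervalIntegrable (fun u => (j : ℂ) * π * I * (g6 u * (u : ℂ))) volume (0:ℝ) 0.002 :=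
      (by fun_prop : Continuous fun u : ℝ => (j : ℂ) * π * I * (g6 u * (u : ℂ))).intervalIntegrable _ _
    rw [← intervalIntegral.integral_const_mul, ← intervalIntegral.integral_sub i1 i2]
    exact intervalIntegral.integral_congr fun u _ => by ring
  have D : (∫ z in (0:ℝ)..0.002, (g6 z - g6 (0.002 + z)))
      = (∫ z in (0:ℝ)..0.002, g6 z) - ∫ z in (0:ℝ)..0.002, g6 (0.002 + z) :=
    intervalIntegral.integral_sub (hg6.intervalIntegrable _ _)
      ((by fun_prop : Continuous fun z => g6 (0.002 + z)).intervalIntegrable _ _)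
  have L : (∫ z in (0:ℝ)..0.002, (g6 (0.002 + z) * (((0.002 - z : ℝ)) : ℂ) + g6 z * (z : ℂ)))
      = (∫ z in (0:ℝ)..0.002, g6 (0.002 + z) * (((0.002 - z : ℝ)) : ℂ))
        + ∫ z in (0:ℝ)..0.002, g6 z * (z : ℂ) :=
    intervalIntegral.integral_add
      ((by fun_prop : Continuous
        fun z => g6 (0.002 + z) * (((0.002 - z : ℝ)) : ℂ)).intervalIntegrable _ _)
      ((by fun_prop : Continuous fun z : ℝ => g6 z * (z : ℂ)).intervalIntegrable _ _)
  unfold S1321 d4F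
  rw [R2, R3, Z2, Z3, D, L]
  generalize (∫ z in (0:ℝ)..0.002, g6 z) = J1
  generalize (∫ z in (0:ℝ)..0.002, g6 (0.002 + z)) = J2
  generalize (∫ z in (0:ℝ)..0.002, g6 (0.002 + z) * (((0.002 - z : ℝ)) : ℂ)) = L1
  generalize (∫ z in (0:ℝ)..0.002, g6 z * (z : ℂ)) = L2
  push_cast
  rw [hπ]
  field_simp
  ring

/-! ### `Θ₁(a₁₄, a₂₂)`: the passage to `d′₅ⱼ + d₅ⱼ` ((10.14)) -/

/-- The two displayed (non-negligible) range contributions to `S_j(a₁₄,a₂₂)/𝔞` (proof of (10.14)), at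
the level `Σₙ → (𝔞/L′²)∫dx/x`, with abstract profiles `𝔤_{j6} = G6`, `𝔤_{j7} = G7`, shift `β = β_j`,
`Λ = log P` (the `m`-sum carries `f̃(log(drm)/log P + 0.004 − α̃)`, whence the breakpoints
`P^{0.496}, P^{0.498}, P^{0.5}`; the scales of `λ₂₂` are `P₃ = P^{0.498}`, `P₂ = P^{0.5}`):
`(500/log²P)∫_{P^{0.496}}^{P^{0.498}}(−1 − β_j log(x/P^{0.496}))(ι₃𝔤_{j6}(P^{0.498}/x)/0.498 + ι₄𝔤_{j7}(P^{0.5}/x)/0.5)dx/x`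
`+ (500/log²P)(ι₄/0.5)∫_{P^{0.498}}^{P^{0.5}}(1 − β_j log(P^{0.5}/x))𝔤_{j7}(P^{0.5}/x)dx/x`
(the range `dr < P^{0.496}` "is `o(α)`"). [cite: Zhang2022LandauSiegel, §10, proof of (10.14)] -/
def S1422 (G6 G7 : ℝ → ℂ) (β : ℂ) (Λ : ℝ) : ℂ :=
  500 / (Λ : ℂ) ^ 2 * (∫ x in Ppow Λ 0.496..Ppow Λ 0.498,
      (-1 - β * (Real.log (x / Ppow Λ 0.496) : ℂ))
        * (iota3 * G6 (Ppow Λ 0.498 / x) / 0.498 + iota4 * G7 (Ppow Λ 0.5 / x) / 0.5) / x)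
    + 500 / (Λ : ℂ) ^ 2 * (iota4 / 0.5) * (∫ x in Ppow Λ 0.498..Ppow Λ 0.5,
      (1 - β * (Real.log (Ppow Λ 0.5 / x) : ℂ)) * G7 (Ppow Λ 0.5 / x) / x)

/-- **`α⁻¹S_j(a₁₄,a₂₂)/𝔞 = d′₅ⱼ + d₅ⱼ` at main order**, for abstract profiles: if `G6(Pᶻ) = g6(z)`,
`G7(Pᶻ) = g7(z)`, `β log P = jπi` and `α log P = π`, then `α⁻¹·S1422 = d5pF g6 + d5F j g6 g7` — the
substitution `x = Pᶻ`, then `u = 0.498 − z` on the first range (`z − 0.496 = 0.002 − u`,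
`0.5 − z = 0.002 + u`) and `u = 0.5 − z` on the second, and regrouping: the constant part of the first
range gives `d′₅ⱼ` and `−(1000ι₄/π)∫₀^{0.002}𝔤𝔥_{j7}(0.002 + u)du`, the rest is `d₅ⱼ`.
[cite: Zhang2022LandauSiegel, §10, proof of (10.14)] -/
theorem S1422_eq_d5F (hα : 0 < α) (hΛ : 0 < Λ) (h : α * Λ = π)
    {G6 G7 g6 g7 : ℝ → ℂ} (hg6 : Continuous g6) (hg7 : Continuous g7)
    (e6 : ∀ z, G6 (Ppow Λ z) = g6 z) (e7 : ∀ z, G7 (Ppow Λ z) = g7 z)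
    {β : ℂ} {j : ℕ} (hβ : β * Λ = (j : ℂ) * π * I) :
    1 / (α : ℂ) * S1422 G6 G7 β Λ = d5pF g6 + d5F j g6 g7 := by
  have hΛ0 : (Λ : ℂ) ≠ 0 := by exact_mod_cast hΛ.ne'
  have hα0 : (α : ℂ) ≠ 0 := by exact_mod_cast hα.ne'
  have hπ0 : (π : ℂ) ≠ 0 := by exact_mod_cast Real.pi_ne_zero
  have hπ : (π : ℂ) = (α : ℂ) * Λ := by rw [← Complex.ofReal_mul, h]
  have hβ' : β = (j : ℂ) * π * I / Λ := by rw [← hβ, mul_div_cancel_right₀ _ hΛ0]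
  -- `x = Pᶻ`, written as functions of `u = 0.498 − z`, resp. `u = 0.5 − z`
  have R2 : (∫ x in Ppow Λ 0.496..Ppow Λ 0.498,
        (-1 - β * (Real.log (x / Ppow Λ 0.496) : ℂ))
          * (iota3 * G6 (Ppow Λ 0.498 / x) / 0.498 + iota4 * G7 (Ppow Λ 0.5 / x) / 0.5) / x)
      = (Λ : ℂ) * ∫ z in (0.496:ℝ)..0.498,
          (-1 - (j : ℂ) * π * I * (((0.002 - (0.498 - z) : ℝ)) : ℂ))
            * (iota3 * g6 (0.498 - z) / 0.498 + iota4 * g7 (0.002 + (0.498 - z)) / 0.5) := by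
    rw [integral_Ppow_Ppow hΛ.le 0.496 0.498
        (fun x => (-1 - β * (Real.log (x / Ppow Λ 0.496) : ℂ))
          * (iota3 * G6 (Ppow Λ 0.498 / x) / 0.498 + iota4 * G7 (Ppow Λ 0.5 / x) / 0.5)),
      intervalIntegral.integral_congr
        (g := fun z => (-1 - (j : ℂ) * π * I * (((0.002 - (0.498 - z) : ℝ)) : ℂ))
            * (iota3 * g6 (0.498 - z) / 0.498 + iota4 * g7 (0.002 + (0.498 - z)) / 0.5))
        fun z _ => by
          have hz : (0.5 : ℝ) - z = 0.002 + (0.498 - z) := by ring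
          simp only [Ppow_div_Ppow', e6, e7, log_Ppow, hz]
          rw [hβ']; push_cast; field_simp; ring]
  have R3 : (∫ x in Ppow Λ 0.498..Ppow Λ 0.5,
        (1 - β * (Real.log (Ppow Λ 0.5 / x) : ℂ)) * G7 (Ppow Λ 0.5 / x) / x)
      = (Λ : ℂ) * ∫ z in (0.498:ℝ)..0.5,
          (1 - (j : ℂ) * π * I * (((0.5 - z : ℝ)) : ℂ)) * g7 (0.5 - z) := by
    rw [integral_Ppow_Ppow hΛ.le 0.498 0.5
        (fun x => (1 - β * (Real.log (Ppow Λ 0.5 / x) : ℂ)) * G7 (Ppow Λ 0.5 / x)),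
      intervalIntegral.integral_congr
        (g := fun z => (1 - (j : ℂ) * π * I * (((0.5 - z : ℝ)) : ℂ)) * g7 (0.5 - z))
        fun z _ => by
          simp only [Ppow_div_Ppow', e7, log_Ppow]
          rw [hβ']; push_cast; field_simp]
  -- first range: `u = 0.498 − z`, split into four pieces
  have Z2 : (∫ z in (0.496:ℝ)..0.498,
        (-1 - (j : ℂ) * π * I * (((0.002 - (0.498 - z) : ℝ)) : ℂ))
          * (iota3 * g6 (0.498 - z) / 0.498 + iota4 * g7 (0.002 + (0.498 - z)) / 0.5))
      = -(iota3 / 0.498) * (∫ u in (0:ℝ)..0.002, g6 u)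
        + -(iota4 / 0.5) * (∫ u in (0:ℝ)..0.002, g7 (0.002 + u))
        + -((j : ℂ) * π * I * iota3 / 0.498) * (∫ u in (0:ℝ)..0.002, (((0.002 - u : ℝ)) : ℂ) * g6 u)
        + -((j : ℂ) * π * I * iota4 / 0.5)
          * (∫ u in (0:ℝ)..0.002, (((0.002 - u : ℝ)) : ℂ) * g7 (0.002 + u)) := by
    rw [intervalIntegral.integral_comp_sub_left
        (fun u => (-1 - (j : ℂ) * π * I * (((0.002 - u : ℝ)) : ℂ))
          * (iota3 * g6 u / 0.498 + iota4 * g7 (0.002 + u) / 0.5)) 0.498,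
      sub_self, show (0.498:ℝ) - 0.496 = 0.002 by norm_num,
      ← intervalIntegral.integral_const_mul, ← intervalIntegral.integral_const_mul,
      ← intervalIntegral.integral_const_mul, ← intervalIntegral.integral_const_mul,
      ← integral_add4 (by fun_prop) (by fun_prop) (by fun_prop) (by fun_prop)]
    exact intervalIntegral.integral_congr fun u _ => by push_cast; ring
  -- second range: `u = 0.5 − z`, split into two pieces
  have Z3 : (∫ z in (0.498:ℝ)..0.5, (1 - (j : ℂ) * π * I * (((0.5 - z : ℝ)) : ℂ)) * g7 (0.5 - z))
      = (∫ u in (0:ℝ)..0.002, g7 u)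
        + -((j : ℂ) * π * I) * (∫ u in (0:ℝ)..0.002, (u : ℂ) * g7 u) := by
    rw [intervalIntegral.integral_comp_sub_left
        (fun u => (1 - (j : ℂ) * π * I * ((u : ℝ) : ℂ)) * g7 u) 0.5,
      sub_self, show (0.5:ℝ) - 0.498 = 0.002 by norm_num,
      ← intervalIntegral.integral_const_mul, ← integral_add2 (by fun_prop) (by fun_prop)]
    exact intervalIntegral.integral_congr fun u _ => by ring
  have D : (∫ z in (0:ℝ)..0.002, (g7 z - g7 (0.002 + z)))
      = (∫ z in (0:ℝ)..0.002, g7 z) - ∫ z in (0:ℝ)..0.002, g7 (0.002 + z) :=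
    integral_sub2 (by fun_prop) (by fun_prop)
  have L : (∫ z in (0:ℝ)..0.002, ((((0.002 - z : ℝ)) : ℂ) * g7 (0.002 + z) + (z : ℂ) * g7 z))
      = (∫ z in (0:ℝ)..0.002, (((0.002 - z : ℝ)) : ℂ) * g7 (0.002 + z))
        + ∫ z in (0:ℝ)..0.002, (z : ℂ) * g7 z :=
    integral_add2 (by fun_prop) (by fun_prop)
  unfold S1422 d5pF d5F
  rw [R2, R3, Z2, Z3, D, L]
  generalize (∫ u in (0:ℝ)..0.002, g6 u) = A1
  generalize (∫ u in (0:ℝ)..0.002, g7 (0.002 + u)) = A2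
  generalize (∫ u in (0:ℝ)..0.002, (((0.002 - u : ℝ)) : ℂ) * g6 u) = A3
  generalize (∫ u in (0:ℝ)..0.002, (((0.002 - u : ℝ)) : ℂ) * g7 (0.002 + u)) = A4
  generalize (∫ u in (0:ℝ)..0.002, (u : ℂ) * g7 u) = A5
  generalize (∫ u in (0:ℝ)..0.002, g7 u) = A6
  push_cast
  rw [hπ]
  field_simp
  ring

/-! ### `Θ₁(a₁₂, a₁₄)`: the passage to `d′₆ⱼ + d₆ⱼ` ((10.15)–(10.16)) -/

/-- The three displayed range contributions to `S_j(a₁₂,a₁₄)/𝔞` (proof of (10.15)–(10.16)), at the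
level `Σₙ → (𝔞/L′²)∫dx/x`, with abstract profiles `𝔣_{j6} = F6`, `𝔣_{j7} = F7`, `𝔶₁ⱼ = Y1`, `𝔶₂ⱼ = Y2`,
`κ = β_{j+1}β_{j+2}`, `Λ = log P` (the `n`-sum carries `f̃(log(drn)/log P + 0.004 − α̃)`: "a result
similar to Lemma 10.2" with breakpoints `P^{0.496}, P^{0.498}, P^{0.5}` and `𝔶_{μj}(P^{0.004}n)`):
`(κ/500)∫₁^{P^{0.496}}(ῑ₃𝔣_{j6}(P^{0.498}/x)/0.498 + ῑ₄𝔣_{j7}(P^{0.5}/x)/0.5)dx/x`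
`+ (500/log²P)∫_{P^{0.496}}^{P^{0.498}}(ῑ₃𝔣_{j6}(P^{0.498}/x)/0.498 + ῑ₄𝔣_{j7}(P^{0.5}/x)/0.5)(−1 + 𝔶₁ⱼ(P^{0.004}x))dx/x`
`+ (1000ῑ₄/log²P)∫_{P^{0.498}}^{P^{0.5}}𝔣_{j7}(P^{0.5}/x)(1 + 𝔶₂ⱼ(P^{0.004}x))dx/x`.
[cite: Zhang2022LandauSiegel, §10, proof of (10.15)–(10.16)] -/
def S1214 (F6 F7 Y1 Y2 : ℝ → ℂ) (κ : ℂ) (Λ : ℝ) : ℂ :=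
  κ / 500 * (∫ x in (1:ℝ)..Ppow Λ 0.496,
      (conj iota3 * F6 (Ppow Λ 0.498 / x) / 0.498 + conj iota4 * F7 (Ppow Λ 0.5 / x) / 0.5) / x)
    + 500 / (Λ : ℂ) ^ 2 * (∫ x in Ppow Λ 0.496..Ppow Λ 0.498,
      (conj iota3 * F6 (Ppow Λ 0.498 / x) / 0.498 + conj iota4 * F7 (Ppow Λ 0.5 / x) / 0.5)
        * (-1 + Y1 (Ppow Λ 0.004 * x)) / x)
    + 1000 * conj iota4 / (Λ : ℂ) ^ 2 * (∫ x in Ppow Λ 0.498..Ppow Λ 0.5,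
      F7 (Ppow Λ 0.5 / x) * (1 + Y2 (Ppow Λ 0.004 * x)) / x)

/-- **`α⁻¹S_j(a₁₂,a₁₄)/𝔞 = d′₆ⱼ + d₆ⱼ` at main order**, for abstract profiles: if `F6(Pᶻ) = f6(z)`,
`F7(Pᶻ) = f7(z)`, `Y1(Pᶻ) = y1(z)`, `Y2(Pᶻ) = y2(z)`, `κ log P = −nπα` and `α log P = π`, then
`α⁻¹·S1214 = d6pF f6 + d6F n f6 f7 y1 y2` — the substitution `x = Pᶻ` (`𝔶(P^{0.004}Pᶻ) = 𝔶𝔶(z + 0.004)`),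
the reflection `z ↦ 0.496 − z` on the first range, `u = 0.498 − z` on the second (`0.004 + z = 0.502 − u`)
and `u = 0.5 − z` on the third (`0.004 + z = 0.504 − u`); the constant part of the second range gives
`d′₆ⱼ` and `−(1000ῑ₄/π)∫₀^{0.002}𝔣𝔣_{j7}(0.002 + u)du`. [cite: Zhang2022LandauSiegel, §10, (10.15)–(10.16)] -/
theorem S1214_eq_d6F (hα : 0 < α) (hΛ : 0 < Λ) (h : α * Λ = π)
    {F6 F7 Y1 Y2 f6 f7 y1 y2 : ℝ → ℂ} (hf6 : Continuous f6) (hf7 : Continuous f7)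
    (hy1 : Continuous y1) (hy2 : Continuous y2)
    (e6 : ∀ z, F6 (Ppow Λ z) = f6 z) (e7 : ∀ z, F7 (Ppow Λ z) = f7 z)
    (ey1 : ∀ z, Y1 (Ppow Λ z) = y1 z) (ey2 : ∀ z, Y2 (Ppow Λ z) = y2 z)
    {κ : ℂ} {n : ℕ} (hκ : κ * Λ = -((n : ℂ) * π * α)) :
    1 / (α : ℂ) * S1214 F6 F7 Y1 Y2 κ Λ = d6pF f6 + d6F n f6 f7 y1 y2 := by
  have hΛ0 : (Λ : ℂ) ≠ 0 := by exact_mod_cast hΛ.ne'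
  have hα0 : (α : ℂ) ≠ 0 := by exact_mod_cast hα.ne'
  have hπ0 : (π : ℂ) ≠ 0 := by exact_mod_cast Real.pi_ne_zero
  have hπ : (π : ℂ) = (α : ℂ) * Λ := by rw [← Complex.ofReal_mul, h]
  have hκ' : κ = -((n : ℂ) * π * α) / Λ := by rw [← hκ, mul_div_cancel_right₀ _ hΛ0]
  -- `x = Pᶻ`
  have R1 : (∫ x in (1:ℝ)..Ppow Λ 0.496,
        (conj iota3 * F6 (Ppow Λ 0.498 / x) / 0.498 + conj iota4 * F7 (Ppow Λ 0.5 / x) / 0.5) / x)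
      = (Λ : ℂ) * ∫ z in (0:ℝ)..0.496, (conj iota3 * f6 (0.002 + (0.496 - z)) / 0.498
          + conj iota4 * f7 (0.004 + (0.496 - z)) / 0.5) := by
    rw [integral_one_Ppow' hΛ.le 0.496
        (fun x => conj iota3 * F6 (Ppow Λ 0.498 / x) / 0.498 + conj iota4 * F7 (Ppow Λ 0.5 / x) / 0.5),
      intervalIntegral.integral_congr
        (g := fun z => conj iota3 * f6 (0.002 + (0.496 - z)) / 0.498
          + conj iota4 * f7 (0.004 + (0.496 - z)) / 0.5)
        fun z _ => by
          have hz : (0.498 : ℝ) - z = 0.002 + (0.496 - z) := by ring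
          have hz' : (0.5 : ℝ) - z = 0.004 + (0.496 - z) := by ring
          simp only [Ppow_div_Ppow', e6, e7, hz, hz']]
  have R2 : (∫ x in Ppow Λ 0.496..Ppow Λ 0.498,
        (conj iota3 * F6 (Ppow Λ 0.498 / x) / 0.498 + conj iota4 * F7 (Ppow Λ 0.5 / x) / 0.5)
          * (-1 + Y1 (Ppow Λ 0.004 * x)) / x)
      = (Λ : ℂ) * ∫ z in (0.496:ℝ)..0.498,
          (conj iota3 * f6 (0.498 - z) / 0.498 + conj iota4 * f7 (0.002 + (0.498 - z)) / 0.5)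
            * (-1 + y1 (0.502 - (0.498 - z))) := by
    rw [integral_Ppow_Ppow hΛ.le 0.496 0.498
        (fun x => (conj iota3 * F6 (Ppow Λ 0.498 / x) / 0.498 + conj iota4 * F7 (Ppow Λ 0.5 / x) / 0.5)
          * (-1 + Y1 (Ppow Λ 0.004 * x))),
      intervalIntegral.integral_congr
        (g := fun z => (conj iota3 * f6 (0.498 - z) / 0.498 + conj iota4 * f7 (0.002 + (0.498 - z)) / 0.5)
            * (-1 + y1 (0.502 - (0.498 - z))))
        fun z _ => by
          have hz : (0.5 : ℝ) - z = 0.002 + (0.498 - z) := by ring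
          have hz' : (0.004 : ℝ) + z = 0.502 - (0.498 - z) := by ring
          simp only [Ppow_div_Ppow', Ppow_mul_Ppow, e6, e7, ey1, hz, hz']]
  have R3 : (∫ x in Ppow Λ 0.498..Ppow Λ 0.5, F7 (Ppow Λ 0.5 / x) * (1 + Y2 (Ppow Λ 0.004 * x)) / x)
      = (Λ : ℂ) * ∫ z in (0.498:ℝ)..0.5, f7 (0.5 - z) * (1 + y2 (0.504 - (0.5 - z))) := by
    rw [integral_Ppow_Ppow hΛ.le 0.498 0.5
        (fun x => F7 (Ppow Λ 0.5 / x) * (1 + Y2 (Ppow Λ 0.004 * x))),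
      intervalIntegral.integral_congr (g := fun z => f7 (0.5 - z) * (1 + y2 (0.504 - (0.5 - z))))
        fun z _ => by
          have hz : (0.004 : ℝ) + z = 0.504 - (0.5 - z) := by ring
          simp only [Ppow_div_Ppow', Ppow_mul_Ppow, e7, ey2, hz]]
  -- first range: `z ↦ 0.496 − z`
  have Z1 : (∫ z in (0:ℝ)..0.496, (conj iota3 * f6 (0.002 + (0.496 - z)) / 0.498
          + conj iota4 * f7 (0.004 + (0.496 - z)) / 0.5))
      = ∫ z in (0:ℝ)..0.496, (conj iota3 * f6 (0.002 + z) / 0.498 + conj iota4 * f7 (0.004 + z) / 0.5) := by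
    rw [integral_reflect (fun u => conj iota3 * f6 (0.002 + u) / 0.498 + conj iota4 * f7 (0.004 + u) / 0.5)
      0.496]
  -- second range: `u = 0.498 − z`, split into three pieces
  have Z2 : (∫ z in (0.496:ℝ)..0.498,
        (conj iota3 * f6 (0.498 - z) / 0.498 + conj iota4 * f7 (0.002 + (0.498 - z)) / 0.5)
          * (-1 + y1 (0.502 - (0.498 - z))))
      = -(conj iota3 / 0.498) * (∫ u in (0:ℝ)..0.002, f6 u)
        + -(conj iota4 / 0.5) * (∫ u in (0:ℝ)..0.002, f7 (0.002 + u))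
        + ∫ u in (0:ℝ)..0.002,
            (conj iota3 * f6 u / 0.498 + conj iota4 * f7 (0.002 + u) / 0.5) * y1 (0.502 - u) := by
    rw [intervalIntegral.integral_comp_sub_left
        (fun u => (conj iota3 * f6 u / 0.498 + conj iota4 * f7 (0.002 + u) / 0.5) * (-1 + y1 (0.502 - u)))
        0.498,
      sub_self, show (0.498:ℝ) - 0.496 = 0.002 by norm_num,
      ← intervalIntegral.integral_const_mul, ← intervalIntegral.integral_const_mul,
      ← integral_add3 (by fun_prop) (by fun_prop) (by fun_prop)]
    exact intervalIntegral.integral_congr fun u _ => by ring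
  -- third range: `u = 0.5 − z`, split into two pieces
  have Z3 : (∫ z in (0.498:ℝ)..0.5, f7 (0.5 - z) * (1 + y2 (0.504 - (0.5 - z))))
      = (∫ u in (0:ℝ)..0.002, f7 u) + ∫ u in (0:ℝ)..0.002, f7 u * y2 (0.504 - u) := by
    rw [intervalIntegral.integral_comp_sub_left (fun u => f7 u * (1 + y2 (0.504 - u))) 0.5,
      sub_self, show (0.5:ℝ) - 0.498 = 0.002 by norm_num, ← integral_add2 (by fun_prop) (by fun_prop)]
    exact intervalIntegral.integral_congr fun u _ => by ring
  have D : (∫ z in (0:ℝ)..0.002, (f7 z - f7 (0.002 + z)))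
      = (∫ z in (0:ℝ)..0.002, f7 z) - ∫ z in (0:ℝ)..0.002, f7 (0.002 + z) :=
    integral_sub2 (by fun_prop) (by fun_prop)
  unfold S1214 d6pF d6F
  rw [R1, R2, R3, Z1, Z2, Z3, D, hκ']
  generalize (∫ z in (0:ℝ)..0.496,
    (conj iota3 * f6 (0.002 + z) / 0.498 + conj iota4 * f7 (0.004 + z) / 0.5)) = I1
  generalize (∫ u in (0:ℝ)..0.002, f6 u) = A1
  generalize (∫ u in (0:ℝ)..0.002, f7 (0.002 + u)) = A2
  generalize (∫ u in (0:ℝ)..0.002,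
    (conj iota3 * f6 u / 0.498 + conj iota4 * f7 (0.002 + u) / 0.5) * y1 (0.502 - u)) = B3
  generalize (∫ u in (0:ℝ)..0.002, f7 u) = A6
  generalize (∫ u in (0:ℝ)..0.002, f7 u * y2 (0.504 - u)) = B4
  push_cast
  rw [hπ]
  field_simp
  ring

/-! ### At the main values of the shifts: the printed `d₃ⱼ, d₄ⱼ, d′₅ⱼ + d₅ⱼ, d′₆ⱼ + d₆ⱼ` and (10.17)

Profiles `𝔣_{jμ} = fX j μ α`, `𝔤_{jμ} = gX b₁ b₂ μ α` (`Section8ChangeOfVariables`; `μ = 3/2, 5/2` for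
`μ = 6, 7`, `(b₁, b₂) = (2,3), (3,1), (1,2)` for `j = 1, 2, 3`), `𝔶_{μj} = yfrak_μ (β_{b₁}⁰) (β_{b₂}⁰) Λ`,
`β_j = β_j⁰ = jiα`, `κ = β_{b₁}⁰β_{b₂}⁰`. -/

/-- `𝔶𝔶₁`-shapes are continuous. [folklore] -/
@[fun_prop] theorem continuous_yy1F (s h : ℚ) : Continuous (yy1F s h) := by unfold yy1F; fun_prop
/-- `𝔶𝔶₂`-shapes are continuous. [folklore] -/
@[fun_prop] theorem continuous_yy2F (s h : ℚ) : Continuous (yy2F s h) := by unfold yy2F; fun_prop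

/-- `𝔣_{jμ}(Pᶻ) = frakf β_j⁰ β_μ⁰ (zΛ)`. [folklore] -/
theorem fX_Ppow (j μ : ℚ) (α Λ z : ℝ) :
    fX j μ α (Ppow Λ z) = frakf (betaMain j α) (betaMain μ α) (z * Λ) := fX_exp j μ α Λ z

/-- `𝔤_{jμ}(Pᶻ) = frakg β_{b₁}⁰ β_{b₂}⁰ β_μ⁰ (zΛ)`. [folklore] -/
theorem gX_Ppow (b1 b2 μ : ℚ) (α Λ z : ℝ) :
    gX b1 b2 μ α (Ppow Λ z) = frakg (betaMain b1 α) (betaMain b2 α) (betaMain μ α) (z * Λ) :=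
  gX_exp b1 b2 μ α Λ z

/-- `β_j⁰ log P = jπi` when `α log P = π`. [cite: Zhang2022LandauSiegel, (2.13), (2.9)] -/
theorem betaMain_mul_Λ (h : α * Λ = π) (j : ℕ) :
    betaMain j α * Λ = (j : ℂ) * π * I := by
  have hπ : (π : ℂ) = (α : ℂ) * Λ := by rw [← Complex.ofReal_mul, h]
  unfold betaMain; rw [hπ]; push_cast; ring

/-- "`β_{j+1}β_{j+2}log P = −(11 − 6j + j²)πα + o(α)`": exact at the main values, `β_{b₁}⁰β_{b₂}⁰ log P
= −b₁b₂πα` with `b₁b₂ = 6, 3, 2 = 11 − 6j + j²` for `j = 1, 2, 3`. [cite: Zhang2022LandauSiegel, §10 before (10.12)] -/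
theorem kappa_main (h : α * Λ = π) (b1 b2 : ℕ) :
    betaMain b1 α * betaMain b2 α * Λ = -(((b1 * b2 : ℕ) : ℂ) * π * α) := by
  have := betaMain_mul_mul_log h b1 b2
  push_cast at this ⊢
  rw [this]; ring

/-- `11 − 6j + j² = 6, 3, 2` for `j = 1, 2, 3`. [cite: Zhang2022LandauSiegel, §10 before (10.12)] -/
theorem eleven_sub_six_j_add_sq :
    (11 - 6 * 1 + 1 ^ 2 = (6:ℤ)) ∧ (11 - 6 * 2 + 2 ^ 2 = (3:ℤ)) ∧ (11 - 6 * 3 + 3 ^ 2 = (2:ℤ)) := by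
  norm_num

/-- `S_j(a₁₁,a₁₃)/𝔞` at main order: `S1113` with `𝔣_{j6}, 𝔣_{j7} = fX j (3/2), fX j (5/2)`,
`𝔶_{μj} = yfrak_μ β_{b₁}⁰ β_{b₂}⁰`, `κ = β_{b₁}⁰β_{b₂}⁰`. [cite: Zhang2022LandauSiegel, §10, proof of (10.12)] -/
def S1113M (j b1 b2 : ℚ) (α Λ : ℝ) : ℂ :=
  S1113 (fX j (3/2) α) (fX j (5/2) α) (yfrak1 (betaMain b1 α) (betaMain b2 α) Λ)
    (yfrak2 (betaMain b1 α) (betaMain b2 α) Λ) (betaMain b1 α * betaMain b2 α) Λ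

/-- `S_j(a₁₃,a₂₁)/𝔞` at main order: `S1321` with `𝔤_{j6} = gX b₁ b₂ (3/2)`, `β = β_j⁰`.
[cite: Zhang2022LandauSiegel, §10, proof of (10.13)] -/
def S1321M (j b1 b2 : ℚ) (α Λ : ℝ) : ℂ := S1321 (gX b1 b2 (3/2) α) (betaMain j α) Λ

/-- `S_j(a₁₄,a₂₂)/𝔞` at main order: `S1422` with `𝔤_{j6}, 𝔤_{j7} = gX b₁ b₂ (3/2), gX b₁ b₂ (5/2)`, `β = β_j⁰`.
[cite: Zhang2022LandauSiegel, §10, proof of (10.14)] -/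
def S1422M (j b1 b2 : ℚ) (α Λ : ℝ) : ℂ :=
  S1422 (gX b1 b2 (3/2) α) (gX b1 b2 (5/2) α) (betaMain j α) Λ

/-- `S_j(a₁₂,a₁₄)/𝔞` at main order: `S1214` with the data of `S1113M`.
[cite: Zhang2022LandauSiegel, §10, proof of (10.15)–(10.16)] -/
def S1214M (j b1 b2 : ℚ) (α Λ : ℝ) : ℂ :=
  S1214 (fX j (3/2) α) (fX j (5/2) α) (yfrak1 (betaMain b1 α) (betaMain b2 α) Λ)
    (yfrak2 (betaMain b1 α) (betaMain b2 α) Λ) (betaMain b1 α * betaMain b2 α) Λ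

/-- `α⁻¹S₁(a₁₁,a₁₃)/𝔞 = d₃₁` at main order. [cite: Zhang2022LandauSiegel, §10, `d₃₁`] -/
theorem S1113M_one (hα : 0 < α) (hΛ : 0 < Λ) (h : α * Λ = π) :
    1 / (α : ℂ) * S1113M 1 2 3 α Λ = d31 :=
  S1113_eq_d3F hα hΛ h continuous_ff16 (continuous_yy1F _ _) (continuous_yy2F _ _)
    (fun z => by rw [fX_Ppow, frakf_main_16 h]) (fun z => by rw [fX_Ppow, frakf_main_17 h])
    (yfrak1_main_1 h) (yfrak2_main_1 h) (by simpa using kappa_main h 2 3)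
/-- `α⁻¹S₂(a₁₁,a₁₃)/𝔞 = d₃₂`. [cite: Zhang2022LandauSiegel, §10, `d₃₂`] -/
theorem S1113M_two (hα : 0 < α) (hΛ : 0 < Λ) (h : α * Λ = π) :
    1 / (α : ℂ) * S1113M 2 3 1 α Λ = d32 :=
  S1113_eq_d3F hα hΛ h continuous_ff26 (continuous_yy1F _ _) (continuous_yy2F _ _)
    (fun z => by rw [fX_Ppow, frakf_main_26 h]) (fun z => by rw [fX_Ppow, frakf_main_27 h])
    (yfrak1_main_2 h) (yfrak2_main_2 h) (by simpa using kappa_main h 3 1)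
/-- `α⁻¹S₃(a₁₁,a₁₃)/𝔞 = d₃₃`. [cite: Zhang2022LandauSiegel, §10, `d₃₃`] -/
theorem S1113M_three (hα : 0 < α) (hΛ : 0 < Λ) (h : α * Λ = π) :
    1 / (α : ℂ) * S1113M 3 1 2 α Λ = d33 :=
  S1113_eq_d3F hα hΛ h continuous_ff36 (continuous_yy1F _ _) (continuous_yy2F _ _)
    (fun z => by rw [fX_Ppow, frakf_main_36 h]) (fun z => by rw [fX_Ppow, frakf_main_37 h])
    (yfrak1_main_3 h) (yfrak2_main_3 h) (by simpa using kappa_main h 1 2)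

/-- `α⁻¹S₁(a₁₃,a₂₁)/𝔞 = d₄₁`. [cite: Zhang2022LandauSiegel, §10, `d₄₁`] -/
theorem S1321M_one (hα : 0 < α) (hΛ : 0 < Λ) (h : α * Λ = π) :
    1 / (α : ℂ) * S1321M 1 2 3 α Λ = d41 :=
  S1321_eq_d4F hα hΛ h continuous_gh16 (fun z => by rw [gX_Ppow, frakg_main_16 hα.ne' h])
    (by simpa using betaMain_mul_Λ h 1)
/-- `α⁻¹S₂(a₁₃,a₂₁)/𝔞 = d₄₂`. [cite: Zhang2022LandauSiegel, §10, `d₄₂`] -/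
theorem S1321M_two (hα : 0 < α) (hΛ : 0 < Λ) (h : α * Λ = π) :
    1 / (α : ℂ) * S1321M 2 3 1 α Λ = d42 :=
  S1321_eq_d4F hα hΛ h continuous_gh26 (fun z => by rw [gX_Ppow, frakg_main_26 hα.ne' h])
    (by simpa using betaMain_mul_Λ h 2)
/-- `α⁻¹S₃(a₁₃,a₂₁)/𝔞 = d₄₃`. [cite: Zhang2022LandauSiegel, §10, `d₄₃`] -/
theorem S1321M_three (hα : 0 < α) (hΛ : 0 < Λ) (h : α * Λ = π) :
    1 / (α : ℂ) * S1321M 3 1 2 α Λ = d43 :=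
  S1321_eq_d4F hα hΛ h continuous_gh36 (fun z => by rw [gX_Ppow, frakg_main_36 hα.ne' h])
    (by simpa using betaMain_mul_Λ h 3)

/-- `α⁻¹S₁(a₁₄,a₂₂)/𝔞 = d′₅₁ + d₅₁`. [cite: Zhang2022LandauSiegel, §10, `d′₅₁, d₅₁`] -/
theorem S1422M_one (hα : 0 < α) (hΛ : 0 < Λ) (h : α * Λ = π) :
    1 / (α : ℂ) * S1422M 1 2 3 α Λ = d5p1 + d51 :=
  S1422_eq_d5F hα hΛ h continuous_gh16 continuous_gh17
    (fun z => by rw [gX_Ppow, frakg_main_16 hα.ne' h]) (fun z => by rw [gX_Ppow, frakg_main_17 hα.ne' h])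
    (by simpa using betaMain_mul_Λ h 1)
/-- `α⁻¹S₂(a₁₄,a₂₂)/𝔞 = d′₅₂ + d₅₂`. [cite: Zhang2022LandauSiegel, §10, `d′₅₂, d₅₂`] -/
theorem S1422M_two (hα : 0 < α) (hΛ : 0 < Λ) (h : α * Λ = π) :
    1 / (α : ℂ) * S1422M 2 3 1 α Λ = d5p2 + d52 :=
  S1422_eq_d5F hα hΛ h continuous_gh26 continuous_gh27
    (fun z => by rw [gX_Ppow, frakg_main_26 hα.ne' h]) (fun z => by rw [gX_Ppow, frakg_main_27 hα.ne' h])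
    (by simpa using betaMain_mul_Λ h 2)
/-- `α⁻¹S₃(a₁₄,a₂₂)/𝔞 = d′₅₃ + d₅₃`. [cite: Zhang2022LandauSiegel, §10, `d′₅₃, d₅₃`] -/
theorem S1422M_three (hα : 0 < α) (hΛ : 0 < Λ) (h : α * Λ = π) :
    1 / (α : ℂ) * S1422M 3 1 2 α Λ = d5p3 + d53 :=
  S1422_eq_d5F hα hΛ h continuous_gh36 continuous_gh37
    (fun z => by rw [gX_Ppow, frakg_main_36 hα.ne' h]) (fun z => by rw [gX_Ppow, frakg_main_37 hα.ne' h])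
    (by simpa using betaMain_mul_Λ h 3)

/-- `α⁻¹S₁(a₁₂,a₁₄)/𝔞 = d′₆₁ + d₆₁`. [cite: Zhang2022LandauSiegel, (10.15)–(10.16), `j = 1`] -/
theorem S1214M_one (hα : 0 < α) (hΛ : 0 < Λ) (h : α * Λ = π) :
    1 / (α : ℂ) * S1214M 1 2 3 α Λ = d6p1 + d61 :=
  S1214_eq_d6F hα hΛ h continuous_ff16 continuous_ff17 (continuous_yy1F _ _) (continuous_yy2F _ _)
    (fun z => by rw [fX_Ppow, frakf_main_16 h]) (fun z => by rw [fX_Ppow, frakf_main_17 h])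
    (yfrak1_main_1 h) (yfrak2_main_1 h) (by simpa using kappa_main h 2 3)
/-- `α⁻¹S₂(a₁₂,a₁₄)/𝔞 = d′₆₂ + d₆₂`. [cite: Zhang2022LandauSiegel, (10.15)–(10.16), `j = 2`] -/
theorem S1214M_two (hα : 0 < α) (hΛ : 0 < Λ) (h : α * Λ = π) :
    1 / (α : ℂ) * S1214M 2 3 1 α Λ = d6p2 + d62 :=
  S1214_eq_d6F hα hΛ h continuous_ff26 continuous_ff27 (continuous_yy1F _ _) (continuous_yy2F _ _)
    (fun z => by rw [fX_Ppow, frakf_main_26 h]) (fun z => by rw [fX_Ppow, frakf_main_27 h])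
    (yfrak1_main_2 h) (yfrak2_main_2 h) (by simpa using kappa_main h 3 1)
/-- `α⁻¹S₃(a₁₂,a₁₄)/𝔞 = d′₆₃ + d₆₃`. [cite: Zhang2022LandauSiegel, (10.15)–(10.16), `j = 3`] -/
theorem S1214M_three (hα : 0 < α) (hΛ : 0 < Λ) (h : α * Λ = π) :
    1 / (α : ℂ) * S1214M 3 1 2 α Λ = d6p3 + d63 :=
  S1214_eq_d6F hα hΛ h continuous_ff36 continuous_ff37 (continuous_yy1F _ _) (continuous_yy2F _ _)
    (fun z => by rw [fX_Ppow, frakf_main_36 h]) (fun z => by rw [fX_Ppow, frakf_main_37 h])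
    (yfrak1_main_3 h) (yfrak2_main_3 h) (by simpa using kappa_main h 1 2)

/-- **(10.1), Proposition 7.1 and (10.12)–(10.17), end to end at main order.** With the weights
`½, 2, 3/2` of Proposition 7.1 and the conjugations of (10.1)
(`Ξ₁* = Θ₁(a₁₁,a₁₃) + conj Θ₁(a₁₃,a₂₁) + Θ₁(a₁₄,a₂₂) + conj Θ₁(a₁₂,a₁₄) + o(𝔓)`), the lemma-level
quantities `α⁻¹S_j(·,·)/𝔞` assemble EXACTLY to the printed `𝔡′ + 𝔡` of (10.17)
(`Section10Defs.dprime`, `dfrak`): the passage "Lemmas 10.1–10.2 ⟹ printed constants" introduces no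
discrepancy, so `Section10Certificate`'s `|𝔡′ + 𝔡| = 5.29897… > 5` is a statement about the §10
main terms themselves. [cite: Zhang2022LandauSiegel, (10.1), (10.12)–(10.17)] -/
theorem xi1_star_main_eq_dprime_add_dfrak (hα : 0 < α) (hΛ : 0 < Λ) (h : α * Λ = π) :
    (1 / 2 * (1 / (α : ℂ) * S1113M 1 2 3 α Λ) + 2 * (1 / (α : ℂ) * S1113M 2 3 1 α Λ)
        + 3 / 2 * (1 / (α : ℂ) * S1113M 3 1 2 α Λ))
      + conj (1 / 2 * (1 / (α : ℂ) * S1321M 1 2 3 α Λ) + 2 * (1 / (α : ℂ) * S1321M 2 3 1 α Λ)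
        + 3 / 2 * (1 / (α : ℂ) * S1321M 3 1 2 α Λ))
      + (1 / 2 * (1 / (α : ℂ) * S1422M 1 2 3 α Λ) + 2 * (1 / (α : ℂ) * S1422M 2 3 1 α Λ)
        + 3 / 2 * (1 / (α : ℂ) * S1422M 3 1 2 α Λ))
      + conj (1 / 2 * (1 / (α : ℂ) * S1214M 1 2 3 α Λ) + 2 * (1 / (α : ℂ) * S1214M 2 3 1 α Λ)
        + 3 / 2 * (1 / (α : ℂ) * S1214M 3 1 2 α Λ))
      = dprime + dfrak := by
  rw [S1113M_one hα hΛ h, S1113M_two hα hΛ h, S1113M_three hα hΛ h, S1321M_one hα hΛ h,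
    S1321M_two hα hΛ h, S1321M_three hα hΛ h, S1422M_one hα hΛ h, S1422M_two hα hΛ h,
    S1422M_three hα hΛ h, S1214M_one hα hΛ h, S1214M_two hα hΛ h, S1214M_three hα hΛ h]
  unfold dprime dfrak
  simp only [map_add, map_mul, map_div₀, map_one, map_ofNat]
  ring

/-- **End to end at main order (Proposition 2.4).** Let `X` be the (10.1)-weighted sum of the
lemma-level quantities `α⁻¹S_j(·,·)/𝔞` (Lemmas 10.1–10.2 residues, §8 profiles, shifts at main values,
`α log P = π`). Then `X = 𝔡′ + 𝔡` (printed (10.17)), hence `|X| > 5` and `Re X > 5.15886`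
(`Section10Certificate.Prop24Main_holds`, `dsum_re_bounds`): "`|Ξ₁*| > 5𝔞𝔓`" of Proposition 2.4 holds at
main order already for the lemma-level quantity — nothing is lost or gained between Lemmas 10.1–10.2
and (10.17). [cite: Zhang2022LandauSiegel, (10.1), (10.17), Proposition 2.4] -/
theorem xi1_star_main_end_to_end (hα : 0 < α) (hΛ : 0 < Λ) (h : α * Λ = π) :
    let X := (1 / 2 * (1 / (α : ℂ) * S1113M 1 2 3 α Λ) + 2 * (1 / (α : ℂ) * S1113M 2 3 1 α Λ)
        + 3 / 2 * (1 / (α : ℂ) * S1113M 3 1 2 α Λ))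
      + conj (1 / 2 * (1 / (α : ℂ) * S1321M 1 2 3 α Λ) + 2 * (1 / (α : ℂ) * S1321M 2 3 1 α Λ)
        + 3 / 2 * (1 / (α : ℂ) * S1321M 3 1 2 α Λ))
      + (1 / 2 * (1 / (α : ℂ) * S1422M 1 2 3 α Λ) + 2 * (1 / (α : ℂ) * S1422M 2 3 1 α Λ)
        + 3 / 2 * (1 / (α : ℂ) * S1422M 3 1 2 α Λ))
      + conj (1 / 2 * (1 / (α : ℂ) * S1214M 1 2 3 α Λ) + 2 * (1 / (α : ℂ) * S1214M 2 3 1 α Λ)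
        + 3 / 2 * (1 / (α : ℂ) * S1214M 3 1 2 α Λ))
    X = dprime + dfrak ∧ (5 : ℝ) < ‖X‖ ∧ (5.15886 : ℝ) < X.re := by
  intro X
  have e : X = dprime + dfrak := xi1_star_main_eq_dprime_add_dfrak hα hΛ h
  refine ⟨e, ?_, ?_⟩
  · rw [e]; exact Prop24Main_holds
  · rw [e]; exact dsum_re_bounds.1

/-! ### §18, proof of (2.33): `Θ₁(a₂₃, a₂₃)` and `d₇ⱼ`, `C₂₃₃`

For `S_j(a₂₃,a₂₃)` the `m`-sum is exactly the sum of Lemma 10.1 (at `ψ`, `y = dr`) and the `n`-sum is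
exactly the sum of Lemma 10.2, so on the two non-negligible ranges the summand of the `n`-sum of §8 is
the product of the two residues: `(500L′/log P)²(−1 − β_j log(y/P₂′))(−1 + 𝔶₁ⱼ(y))` on
`P₂′ ≤ y < P₃′` (`lemma101_range2 · lemma102_range2`) and `(500L′/log P)²(1 − β_j log(P₁′/y))(1 + 𝔶₂ⱼ(y))`
on `P₃′ ≤ y < P₁′` (`lemma101_range3 · lemma102_range3`). The manuscript's second display prints
`(1 + 𝔶₁ⱼ(n))` on the latter range; at lemma level the factor is `1 + 𝔶₂ⱼ` (Lemma 10.2, (10.10)), which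
is the reading `Section10Defs.d7F` (the verbatim one being `d7litF`). -/

/-- The two displayed range contributions to `S_j(a₂₃,a₂₃)/𝔞` (§18, proof of (2.33)) at the level
`Σₙ → (𝔞/L′²)∫dx/x`, the summand being the product of the Lemma 10.1 and Lemma 10.2 residues
(`lemma101_range2/3`, `lemma102_range2/3`), with abstract `𝔶₁ⱼ = Y1`, `𝔶₂ⱼ = Y2`, `β = β_j`, `Λ = log P`:
`(500/log P)²(∫_{P^{0.5}}^{P^{0.502}}(−1 − β_j log(x/P^{0.5}))(−1 + 𝔶₁ⱼ(x))dx/x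
+ ∫_{P^{0.502}}^{P^{0.504}}(1 − β_j log(P^{0.504}/x))(1 + 𝔶₂ⱼ(x))dx/x)`.
[cite: Zhang2022LandauSiegel, §18 proof of (2.33); Lemmas 10.1, 10.2] -/
def S2323 (Y1 Y2 : ℝ → ℂ) (β : ℂ) (Λ : ℝ) : ℂ :=
  (500 / (Λ : ℂ)) ^ 2 * (∫ x in Ppow Λ 0.5..Ppow Λ 0.502,
      (-1 - β * (Real.log (x / Ppow Λ 0.5) : ℂ)) * (-1 + Y1 x) / x)
    + (500 / (Λ : ℂ)) ^ 2 * (∫ x in Ppow Λ 0.502..Ppow Λ 0.504,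
      (1 - β * (Real.log (Ppow Λ 0.504 / x) : ℂ)) * (1 + Y2 x) / x)

/-- **`(α𝔞)⁻¹S_j(a₂₃,a₂₃) = d₇ⱼ` at main order**, for abstract profiles: if `Y1(Pᶻ) = y1(z)`,
`Y2(Pᶻ) = y2(z)`, `β log P = jπi` and `α log P = π`, then `α⁻¹·S2323 = d7F j y1 y2` (the substitution
`x = Pᶻ` alone; `d7F` is written in the variable `z`). In particular the lemma-level main term is
`Section10Defs.d7F` (with `𝔶𝔶₂ⱼ` on `[0.502, 0.504]`), not the verbatim `d7litF`.
[cite: Zhang2022LandauSiegel, §18 proof of (2.33); Lemmas 10.1, 10.2] -/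
theorem S2323_eq_d7F (hα : 0 < α) (hΛ : 0 < Λ) (h : α * Λ = π)
    {Y1 Y2 y1 y2 : ℝ → ℂ} (ey1 : ∀ z, Y1 (Ppow Λ z) = y1 z) (ey2 : ∀ z, Y2 (Ppow Λ z) = y2 z)
    {β : ℂ} {j : ℕ} (hβ : β * Λ = (j : ℂ) * π * I) :
    1 / (α : ℂ) * S2323 Y1 Y2 β Λ = d7F j y1 y2 := by
  have hΛ0 : (Λ : ℂ) ≠ 0 := by exact_mod_cast hΛ.ne'
  have hα0 : (α : ℂ) ≠ 0 := by exact_mod_cast hα.ne'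
  have hπ0 : (π : ℂ) ≠ 0 := by exact_mod_cast Real.pi_ne_zero
  have hπ : (π : ℂ) = (α : ℂ) * Λ := by rw [← Complex.ofReal_mul, h]
  have hβ' : β = (j : ℂ) * π * I / Λ := by rw [← hβ, mul_div_cancel_right₀ _ hΛ0]
  have R2 : (∫ x in Ppow Λ 0.5..Ppow Λ 0.502,
        (-1 - β * (Real.log (x / Ppow Λ 0.5) : ℂ)) * (-1 + Y1 x) / x)
      = (Λ : ℂ) * ∫ z in (0.5:ℝ)..0.502, (-1 - (j : ℂ) * π * I * (z - 0.5)) * (-1 + y1 z) := by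
    rw [integral_Ppow_Ppow hΛ.le 0.5 0.502
        (fun x => (-1 - β * (Real.log (x / Ppow Λ 0.5) : ℂ)) * (-1 + Y1 x)),
      intervalIntegral.integral_congr
        (g := fun z => (-1 - (j : ℂ) * π * I * (z - 0.5)) * (-1 + y1 z))
        fun z _ => by
          simp only [Ppow_div_Ppow', ey1, log_Ppow]
          rw [hβ']; push_cast; field_simp]
  have R3 : (∫ x in Ppow Λ 0.502..Ppow Λ 0.504,
        (1 - β * (Real.log (Ppow Λ 0.504 / x) : ℂ)) * (1 + Y2 x) / x)
      = (Λ : ℂ) * ∫ z in (0.502:ℝ)..0.504, (1 - (j : ℂ) * π * I * (0.504 - z)) * (1 + y2 z) := by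
    rw [integral_Ppow_Ppow hΛ.le 0.502 0.504
        (fun x => (1 - β * (Real.log (Ppow Λ 0.504 / x) : ℂ)) * (1 + Y2 x)),
      intervalIntegral.integral_congr
        (g := fun z => (1 - (j : ℂ) * π * I * (0.504 - z)) * (1 + y2 z))
        fun z _ => by
          simp only [Ppow_div_Ppow', ey2, log_Ppow]
          rw [hβ']; push_cast; field_simp]
  unfold S2323 d7F
  rw [R2, R3]
  generalize (∫ z in (0.5:ℝ)..0.502, (-1 - (j : ℂ) * π * I * (z - 0.5)) * (-1 + y1 z)) = K1
  generalize (∫ z in (0.502:ℝ)..0.504, (1 - (j : ℂ) * π * I * (0.504 - z)) * (1 + y2 z)) = K2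
  push_cast
  rw [hπ]
  field_simp

/-- `S_j(a₂₃,a₂₃)/𝔞` at main order: `S2323` with `𝔶_{μj} = yfrak_μ β_{b₁}⁰ β_{b₂}⁰`, `β = β_j⁰`.
[cite: Zhang2022LandauSiegel, §18 proof of (2.33)] -/
def S2323M (j b1 b2 : ℚ) (α Λ : ℝ) : ℂ :=
  S2323 (yfrak1 (betaMain b1 α) (betaMain b2 α) Λ) (yfrak2 (betaMain b1 α) (betaMain b2 α) Λ)
    (betaMain j α) Λ

/-- `(α𝔞)⁻¹S₁(a₂₃,a₂₃) = d₇₁` at main order. [cite: Zhang2022LandauSiegel, §18 proof of (2.33)] -/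
theorem S2323M_one (hα : 0 < α) (hΛ : 0 < Λ) (h : α * Λ = π) :
    1 / (α : ℂ) * S2323M 1 2 3 α Λ = d71 :=
  S2323_eq_d7F hα hΛ h (yfrak1_main_1 h)
    (yfrak2_main_1 h) (by simpa using betaMain_mul_Λ h 1)
/-- `(α𝔞)⁻¹S₂(a₂₃,a₂₃) = d₇₂`. [cite: Zhang2022LandauSiegel, §18 proof of (2.33)] -/
theorem S2323M_two (hα : 0 < α) (hΛ : 0 < Λ) (h : α * Λ = π) :
    1 / (α : ℂ) * S2323M 2 3 1 α Λ = d72 :=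
  S2323_eq_d7F hα hΛ h (yfrak1_main_2 h)
    (yfrak2_main_2 h) (by simpa using betaMain_mul_Λ h 2)
/-- `(α𝔞)⁻¹S₃(a₂₃,a₂₃) = d₇₃`. [cite: Zhang2022LandauSiegel, §18 proof of (2.33)] -/
theorem S2323M_three (hα : 0 < α) (hΛ : 0 < Λ) (h : α * Λ = π) :
    1 / (α : ℂ) * S2323M 3 1 2 α Λ = d73 :=
  S2323_eq_d7F hα hΛ h (yfrak1_main_3 h)
    (yfrak2_main_3 h) (by simpa using betaMain_mul_Λ h 3)

/-- **(18.3), Proposition 7.1 and (2.33) at main order, end to end**: `2Re{Σⱼ cⱼ α⁻¹S_j(a₂₃,a₂₃)/𝔞}`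
with `c = (½, 2, 3/2)` is EXACTLY `Section10Defs.C233` (certified `= 2546.8… < 3000` in
`Section10Certificate`). [cite: Zhang2022LandauSiegel, (18.3), (2.33)] -/
theorem theta1_a23_main_eq_C233 (hα : 0 < α) (hΛ : 0 < Λ) (h : α * Λ = π) :
    2 * (1 / 2 * (1 / (α : ℂ) * S2323M 1 2 3 α Λ) + 2 * (1 / (α : ℂ) * S2323M 2 3 1 α Λ)
        + 3 / 2 * (1 / (α : ℂ) * S2323M 3 1 2 α Λ)).re = C233 := by
  rw [S2323M_one hα hΛ h, S2323M_two hα hΛ h, S2323M_three hα hΛ h]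
  rfl

/-- **End to end at main order ((2.33)).** `2Re{Σⱼ cⱼ α⁻¹S_j(a₂₃,a₂₃)/𝔞} = C₂₃₃ < 3000`
(`Section10Certificate.Ineq233_holds`, `C233_bounds`: `2546.8476 < C₂₃₃ < 2546.8478`): the printed
(2.33) holds at main order for the lemma-level quantity. [cite: Zhang2022LandauSiegel, (18.3), (2.33)] -/
theorem theta1_a23_main_end_to_end (hα : 0 < α) (hΛ : 0 < Λ) (h : α * Λ = π) :
    let Y := 2 * (1 / 2 * (1 / (α : ℂ) * S2323M 1 2 3 α Λ) + 2 * (1 / (α : ℂ) * S2323M 2 3 1 α Λ)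
        + 3 / 2 * (1 / (α : ℂ) * S2323M 3 1 2 α Λ)).re
    Y = C233 ∧ Y < 3000 ∧ (2546.8476 : ℝ) < Y := by
  intro Y
  have e : Y = C233 := theta1_a23_main_eq_C233 hα hΛ h
  refine ⟨e, ?_, ?_⟩
  · rw [e]; exact Ineq233_holds
  · rw [e]; exact C233_bounds.1

end PartB

end Literature.NumberTheory.LFunctions.Zhang2022

end
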